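import Literature.Analysis.FluidPDE.AxisymNoSwirlLpDissipation
import Literature.Analysis.FluidPDE.AxisymOmegaThetaEnergy
import Mathlib.Analysis.SpecialFunctions.Pow.Deriv
import HarnessLib

/-!
# Axisymmetric flows without swirl: the `L^{2k}(Ω, dr dz)` balance of `ω_θ` WITH its dissipation
# (Gallay–Šverák 2015, proof of Prop. 5.3, (5.8), for all even exponents)

Analysis/FluidPDE proof file (theorems only; no definitions, no named facts).

Gallay–Šverák (*Remarks on the Cauchy problem for the axisymmetric Navier–Stokes equations*,
Confluentes Math. 7 (2015) 67–92 = arXiv:1510.01036) prove their scale-invariant a-priori bound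
(1.11) `t‖ω_θ(t)‖_{L^∞} ≤ C(‖ω₀‖_{L¹(Ω)})` (Prop. 5.3) from the `L²(Ω)` energy identity of the
azimuthal vorticity on the half-plane `Ω = {(r,z) : r > 0}` with the measure `dr dz` (arXiv p. 16,
(5.8)):

> "`d/dt ∫_Ω ω_θ² dr dz = −2∫_Ω |∇ω_θ|² dr dz + ∫_Ω (u_r/r − 1/r²) ω_θ² dr dz`."

This file proves the analogous balance for ALL even exponents `p = 2k`, `k ≥ 3`, keeping the
dissipation in the form needed by a Nash iteration on `Ω` (Feng–Šverák, arXiv:1301.6317, proof of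
Lemma 3.8: "`−dE_p/dt ≥ (4(p−1)/p) ∫ |∇(η^{p/2})|²`", there for `η = ω_θ/r` on `ℝ³`). In the
tree's `ℝ³` vocabulary (`η = angVortQuot u = ω_θ/r`, `r = cylRadius`, `dx = r dr dθ dz`, so that
`∫_Ω ω_θ^{2k} dr dz = (2π)⁻¹ ∫ r^{2k−1} η^{2k} dx` and, with `h = r^k η^k = ω_θ^k`,
`∫_Ω |∇(ω_θ^k)|² dr dz = (2π)⁻¹ ∫ ‖∇h‖²/r dx`):

* `contDiff_one_cylRadius_pow_mul_pow` — `ω_θ^k = r^k η^k` is `C¹` for `η ∈ C¹`, `k ≥ 2`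
  (`y ↦ r(y)ⁿ` is `C¹` for `n ≥ 2` with `D(rⁿ)(x)v = n r^{n−2} (x₀v₀ + x₁v₁)`, through
  `rⁿ = (r²)^{n/2}` and `Real.rpow`).
* `cylRadius_mul_sq_mul_dissipDensity_eq_norm_fderiv_sq` — the pointwise identity
  `r · k² X = ‖D(r^k S^k)‖²`, `X = r^{2k−3}S^{2k} + 2 r^{2k−1}S^{2k−1}(∂ᵣS)/r
  + r^{2k−1}S^{2k−2}‖DS‖²` (`k ≥ 3`, `(∂ᵣS)/r = radDerivQuot S`), identifying the dissipation below with
  `∫ ‖∇(ω_θ^k)‖²/r dx = 2π ∫_Ω |∇(ω_θ^k)|² dr dz`.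
* `integral_weight_pow_mul_deriv_add_dissipation_le_of_drift_laplacian` — **the fixed-time
  inequality.** For an axisymmetric scalar `S ∈ C²` with `|S| ≤ F`, `r|S| ≤ L`,
  `S, ∂ᵢS, ∂ᵢ∂ᵢS, (∂ᵣS)/r, rS, r∂ᵢS ∈ L²`, a divergence-free `b ∈ C¹` bounded with bounded
  derivative, `ν ≥ 0`, `k ≥ 3`, and the swirl-free `η`-equation `S' + DS[b] = ν(ΔS + 2(∂ᵣS)/r)`:
  `∫ 2k r^{2k−1} S^{2k−1} S' dx + ν · 2(2k−1)k ∫ X dx ≤ (2k−1) ∫ r^{2k−3}(x₀b₀ + x₁b₁) S^{2k} dx`.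
  In `Ω`-language (`p = 2k`, `ω_θ = rS`, `dx = 2π r dr dz`):
  `d/dt ∫_Ω ω_θ^p + (4(p−1)/p) ∫_Ω |∇(ω_θ^{p/2})|² ≤ (p−1) ∫_Ω (u_r/r) ω_θ^p`, the
  transport term contributing `(p−1)∫(u_r/r)ω_θ^p` because `div_*(u) = −u_r/r` on `Ω`, the
  diffusion `−p(p−1)∫ω_θ^{p−2}|∇ω_θ|² = −(4(p−1)/p)∫|∇ω_θ^{p/2}|²` and the zeroth-order term
  `−(p−1)∫ω_θ^p/r² ≤ 0` (dropped), exactly as in (5.8) for `p = 2`. (Three whole-space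
  integrations by parts on `ℝ³`; the weights `r^{2k−1}`, `r^{2k−3}xᵢ` are `C¹` because `k ≥ 3`.)
* `IsTaoSolutionOn.exists_forall_cylRadius_mul_abs_angVortQuot_le`,
  `IsTaoSolutionOn.memLp_cylRadius_mul_angVortQuot` — in Tao's class with axisymmetric slices,
  `|ω_θ| = r|η|` is bounded on the slab and `rη, r∂ᵢη ∈ L²` at each time
  (`r|∂ᵢη| ≤ |∂ᵢη| + 3‖ω‖ + ‖Dω‖`).
* `IsTaoSolutionOn.integral_weight_pow_mul_angVortQuot_deriv_add_dissipation_le` — the fixed-time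
  inequality along a Tao-class solution with axisymmetric swirl-free slices (`S = η(t)`,
  `S' = η'(t)`, `b = u(t)`), the transport term bounded by `(2k−1) W ∫ r^{2k−1}η^{2k}` for any
  upper bound `u_r/r ≤ W`.
* `IsTaoSolutionOn.integral_weight_pow_angVortQuot_balance` — **the balance**:
  `F_k(t) − F_k(s) = ∫ₛᵗ σ_k` for `0 ≤ s ≤ t ≤ T`, `F_k(τ) = ∫ r^{2k−1}η(τ)^{2k}`,
  `σ_k(τ) = ∫ 2k r^{2k−1}η^{2k−1}η'`, with `F_k` continuous on `[0, T]` and `σ_k` integrable on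
  `(0, T)` — the input of the ODE comparison
  `Literature.Analysis.ODE.le_mul_rpow_of_sub_eq_integral_of_slice_le`.

WHAT THIS IS NOT: not a statement about blow-up or regularity of Navier–Stokes — a-priori
identities for the azimuthal vorticity of smooth axisymmetric swirl-free solutions.

## Mathlib / tree search

Tree (used): `integral_mul_fderiv_apply_eq_neg_of_isDivFree'` (`AxisymTransportIBP`),
`integral_mul_fderiv_eq_neg_of_differentiable` (`HouLeiLiEstimate`), `mul_radDerivQuot_eq_fderiv_zero`
/ `…_one` (`AxisymRadialQuotient`), `hasFDerivAt_cylRadius_sq` (`AxisymmetricVorticityTransport`),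
`fderiv_apply_eq_sum_three` (`AxisymOmegaEnergy`), `laplacian_eq_sum_fderiv_fderiv`,
`IsTaoSolutionOn.memLp_angVortQuot_data`, `…exists_lintegral_sq_quot_le`, `…exists_bound_fderiv_velocity`,
`exists_bound_velocity`, `IsClassicalNSSolutionOn.angVortQuot_eq`, `IsSmoothSpaceTimeOn.angVortQuot_family`,
`…timeDerivWithin_angVortQuot`, `integral_comp_eq_add_of_ae_hasDerivAt`,
`aestronglyMeasurable_prod_of_continuousOn_off_axis`, `norm_curl_eq_cylRadius_mul_abs_angVortQuot`,
`IsTaoSolutionOn.exists_forall_abs_angVortQuot_le` (`AxisymNoSwirlLpDissipation`, the `k`-free twin of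
this file: the `L^p(ℝ³)` balance of `η`), `IsAxisymmetric.cylRadius_mul_abs_fderiv_angVortQuot_le`,
`IsAxisymmetric.cylRadius_mul_abs_angVortQuot_le`, `memLp_of_norm_le_const_mul` (`AxisymOmegaThetaEnergy`),
`norm_iteratedFDeriv_curl_le`, `memLp_two_of_norm_le_of_lintegral`, `IsTaoSolutionOn.exists_lintegral_sq_quot_le`. `lean search 'OmegaLp|weight_pow_mul|cylRadius_pow_mul_pow'`
(2026-08-27): nothing; the tree's weighted slice `integral_weight_mul_deriv_comp_mul_le_of_drift_laplacian`
(`AxisymNoSwirlWeightedCoSignedFluxSlice`) takes BOUNDED weights and discards the dissipation.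
Mathlib: `HasFDerivAt.rpow_const`, `Real.contDiff_rpow_const_of_le`, `Real.rpow_natCast`,
`Real.rpow_mul`.

## References

* Th. Gallay, V. Šverák, Confluentes Math. 7 (2015) 67–92 = arXiv:1510.01036, proof of Prop. 5.3,
  (5.8) (arXiv p. 16). [GallaySverak2016]
* H. Feng, V. Šverák, Arch. Ration. Mech. Anal. 215 (2015) 89–123 = arXiv:1301.6317, proof of
  Lemma 3.8 (arXiv p. 12). [FengSverak2015]
-/

noncomputable section

open MeasureTheory Set Function Filter Topology InnerProductSpace WithLp
open scoped RealInnerProductSpace Laplacian ContDiff ENNReal NNReal Topology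

namespace Literature.Analysis.FluidPDE

/-! ### The weights `rⁿ`, `n ≥ 2`: differentiability through `rⁿ = (r²)^{n/2}` -/

section Weights

/-- `(r²)^{n/2} = rⁿ` (real power, `r ≥ 0`). [folklore] -/
private theorem cylRadius_sq_rpow_half (x : EuclideanSpace ℝ (Fin 3)) (n : ℕ) :
    (cylRadius x ^ 2) ^ ((n : ℝ) / 2) = cylRadius x ^ n := by
  have hr := cylRadius_nonneg x
  rw [show cylRadius x ^ 2 = cylRadius x ^ (2 : ℝ) by norm_cast, ← Real.rpow_mul hr,
    show (2 : ℝ) * ((n : ℝ) / 2) = (n : ℝ) by ring, Real.rpow_natCast]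

/-- `|x₀| ≤ r`, `|x₁| ≤ r`. [folklore] -/
private theorem abs_apply_le_cylRadius (x : EuclideanSpace ℝ (Fin 3)) :
    |x 0| ≤ cylRadius x ∧ |x 1| ≤ cylRadius x := by
  have hr := cylRadius_nonneg x
  have hsq := cylRadius_sq x
  constructor
  · rw [← Real.sqrt_sq_eq_abs, ← Real.sqrt_sq hr]
    exact Real.sqrt_le_sqrt (by nlinarith [sq_nonneg (x 1)])
  · rw [← Real.sqrt_sq_eq_abs, ← Real.sqrt_sq hr]
    exact Real.sqrt_le_sqrt (by nlinarith [sq_nonneg (x 0)])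

/-- **`D(rⁿ)(x) v = n r^{n−2} (x₀v₀ + x₁v₁)` for `n ≥ 2`** (`rⁿ = (r²)^{n/2}` and the chain rule for
the real power `t ↦ t^{n/2}`, `n/2 ≥ 1`). [folklore] -/
private theorem hasFDerivAt_cylRadius_pow {n : ℕ} (hn : 2 ≤ n) (x : EuclideanSpace ℝ (Fin 3)) :
    HasFDerivAt (fun y : EuclideanSpace ℝ (Fin 3) => cylRadius y ^ n)
      (((n : ℝ) * cylRadius x ^ (n - 2)) •
        ((x 0) • (EuclideanSpace.proj (0 : Fin 3) : EuclideanSpace ℝ (Fin 3) →L[ℝ] ℝ) +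
          (x 1) • (EuclideanSpace.proj (1 : Fin 3) : EuclideanSpace ℝ (Fin 3) →L[ℝ] ℝ))) x := by
  have hfun : (fun y : EuclideanSpace ℝ (Fin 3) => cylRadius y ^ n) =
      fun y => (cylRadius y ^ 2) ^ ((n : ℝ) / 2) := funext fun y => (cylRadius_sq_rpow_half y n).symm
  rw [hfun]
  have hp : (1 : ℝ) ≤ (n : ℝ) / 2 := by
    rw [le_div_iff₀ two_pos]; exact_mod_cast hn
  have h := (hasFDerivAt_cylRadius_sq x).rpow_const (p := (n : ℝ) / 2) (Or.inr hp)
  refine h.congr_fderiv ?_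
  have hexp : (cylRadius x ^ 2) ^ ((n : ℝ) / 2 - 1) = cylRadius x ^ (n - 2) := by
    rw [show (n : ℝ) / 2 - 1 = ((n - 2 : ℕ) : ℝ) / 2 by rw [Nat.cast_sub hn]; push_cast; ring]
    exact cylRadius_sq_rpow_half x (n - 2)
  rw [hexp]
  ext v
  simp only [_root_.add_apply, _root_.smul_apply, smul_eq_mul, PiLp.proj_apply]
  ring

/-- The value `D(rⁿ)(x) v = n r^{n−2} (x₀v₀ + x₁v₁)` (`n ≥ 2`). [folklore] -/
private theorem fderiv_cylRadius_pow_apply {n : ℕ} (hn : 2 ≤ n) (x v : EuclideanSpace ℝ (Fin 3)) :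
    fderiv ℝ (fun y : EuclideanSpace ℝ (Fin 3) => cylRadius y ^ n) x v =
      (n : ℝ) * cylRadius x ^ (n - 2) * (x 0 * v 0 + x 1 * v 1) := by
  rw [(hasFDerivAt_cylRadius_pow hn x).fderiv]
  simp only [_root_.add_apply, _root_.smul_apply, smul_eq_mul, PiLp.proj_apply]

/-- `y ↦ r(y)ⁿ` is `C¹` for `n ≥ 2`. [folklore] -/
private theorem contDiff_one_cylRadius_pow {n : ℕ} (hn : 2 ≤ n) :
    ContDiff ℝ 1 (fun y : EuclideanSpace ℝ (Fin 3) => cylRadius y ^ n) := by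
  have hfun : (fun y : EuclideanSpace ℝ (Fin 3) => cylRadius y ^ n) =
      fun y => (cylRadius y ^ 2) ^ ((n : ℝ) / 2) := funext fun y => (cylRadius_sq_rpow_half y n).symm
  rw [hfun]
  have hp : ((1 : ℕ) : ℝ) ≤ (n : ℝ) / 2 := by
    rw [Nat.cast_one, le_div_iff₀ two_pos]; exact_mod_cast hn
  have h2 : ContDiff ℝ 1 (fun y : EuclideanSpace ℝ (Fin 3) => cylRadius y ^ 2) := by
    have : (fun y : EuclideanSpace ℝ (Fin 3) => cylRadius y ^ 2) = fun y => y 0 ^ 2 + y 1 ^ 2 :=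
      funext fun y => cylRadius_sq y
    rw [this]; exact contDiff_horizSq
  exact (Real.contDiff_rpow_const_of_le hp).comp h2

/-- `y ↦ r(y)ⁿ` is differentiable for `n ≥ 2`. [folklore] -/
private theorem differentiable_cylRadius_pow {n : ℕ} (hn : 2 ≤ n) :
    Differentiable ℝ (fun y : EuclideanSpace ℝ (Fin 3) => cylRadius y ^ n) := fun x =>
  (hasFDerivAt_cylRadius_pow hn x).differentiableAt

/-- **`ω_θ^k = r^k η^k` is `C¹`** for `η ∈ C¹` and `k ≥ 2` (the power `ω_θ^{p/2}` whose gradient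
enters Nash's inequality in the `L^p` energy estimates; `r^k` is `C¹` for `k ≥ 2`).
[cite: FengSverak2015, proof of Lemma 3.8, `∇[(η)^{p/2}]` (arXiv p. 12); GallaySverak2016, proof of
Prop. 5.3, (5.8) (arXiv p. 16)] -/
theorem contDiff_one_cylRadius_pow_mul_pow {S : EuclideanSpace ℝ (Fin 3) → ℝ} {k : ℕ} (hk : 2 ≤ k)
    (hS : ContDiff ℝ 1 S) : ContDiff ℝ 1 fun y : EuclideanSpace ℝ (Fin 3) => cylRadius y ^ k * S y ^ k :=
  (contDiff_one_cylRadius_pow hk).mul (hS.pow k)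

end Weights

/-! ### Pointwise calculus for an axisymmetric scalar: `x₀∂₀S + x₁∂₁S = r² (∂ᵣS)/r` -/

section Pointwise

variable {S : EuclideanSpace ℝ (Fin 3) → ℝ}

/-- `x₀ ∂₀S + x₁ ∂₁S = r² · radDerivQuot S` for an axisymmetric scalar `S ∈ C²`. [folklore] -/
private theorem horizontal_inner_fderiv_eq_cylRadius_sq_mul_radDerivQuot (hS : ContDiff ℝ 2 S)
    (hax : IsAxisymmetricScalar S) (x : EuclideanSpace ℝ (Fin 3)) :
    x 0 * fderiv ℝ S x (EuclideanSpace.single 0 1) + x 1 * fderiv ℝ S x (EuclideanSpace.single 1 1) =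
      cylRadius x ^ 2 * radDerivQuot S x := by
  rw [← mul_radDerivQuot_eq_fderiv_zero hS hax x, ← mul_radDerivQuot_eq_fderiv_one hS hax x,
    cylRadius_sq]
  ring

end Pointwise

/-! ### `‖L‖² = Σᵢ L(eᵢ)²` for a linear functional on `ℝ³` -/

/-- For a linear functional on `ℝ³`, `‖L‖² = ∑ᵢ L(eᵢ)²` (Riesz; private copy of the lemma of
`AxisymNoSwirlLpDissipation`). [folklore] -/
private theorem norm_sq_eq_sum_sq_single (L : EuclideanSpace ℝ (Fin 3) →L[ℝ] ℝ) :
    ‖L‖ ^ 2 = ∑ i : Fin 3, (L (EuclideanSpace.single i (1 : ℝ))) ^ 2 := by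
  set v : EuclideanSpace ℝ (Fin 3) := (InnerProductSpace.toDual ℝ (EuclideanSpace ℝ (Fin 3))).symm L
    with hv
  have hL : ∀ w, L w = ⟪v, w⟫ := fun w => by rw [hv, InnerProductSpace.toDual_symm_apply]
  have hn : ‖L‖ = ‖v‖ := by rw [hv, LinearIsometryEquiv.norm_map]
  rw [hn, EuclideanSpace.real_norm_sq_eq]
  refine Finset.sum_congr rfl fun i _ => ?_
  rw [hL, EuclideanSpace.inner_single_right]
  simp

/-- Chain rule `D(Sⁿ)(x) v = n S^{n−1} DS(x) v`. [folklore] -/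
private theorem fderiv_pow_apply' {S : EuclideanSpace ℝ (Fin 3) → ℝ} (hSd : Differentiable ℝ S) (n : ℕ)
    (x v : EuclideanSpace ℝ (Fin 3)) :
    fderiv ℝ (fun y => S y ^ n) x v = n * S x ^ (n - 1) * fderiv ℝ S x v := by
  rw [((hSd x).hasFDerivAt.pow n).fderiv]
  simp [smul_eq_mul, nsmul_eq_mul]

/-! ### The dissipation density: `r · k²(…) = ‖D(r^k S^k)‖²` -/

section DissipationDensity

variable {S : EuclideanSpace ℝ (Fin 3) → ℝ} {k : ℕ}

/-- **`r · k² (r^{2k−3}S^{2k} + 2 r^{2k−1}S^{2k−1}(∂ᵣS)/r + r^{2k−1}S^{2k−2}‖DS‖²) = ‖D(r^k S^k)‖²`**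
for `k ≥ 3` and an axisymmetric scalar `S ∈ C²` (`(∂ᵣS)/r = radDerivQuot S`,
`x₀∂₀S + x₁∂₁S = r²·(∂ᵣS)/r`): the dissipation functional of
`integral_weight_pow_mul_deriv_add_dissipation_le_of_drift_laplacian` is
`∫ ‖∇(ω_θ^k)‖²/r dx = 2π ∫_Ω |∇(ω_θ^k)|² dr dz` (`ω_θ = r S`) — Feng–Šverák's
`p(p−1) η^{p−2}|∇η|² = (4(p−1)/p)|∇(η^{p/2})|²` bookkeeping for the weighted power `ω_θ^{p/2}`.
[cite: FengSverak2015, proof of Lemma 3.8, the display for `−dE_p/dt` (arXiv p. 12); GallaySverak2016,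
proof of Prop. 5.3, (5.8) (arXiv p. 16)] -/
theorem cylRadius_mul_sq_mul_dissipDensity_eq_norm_fderiv_sq (hk : 3 ≤ k) (hS : ContDiff ℝ 2 S)
    (hax : IsAxisymmetricScalar S) (x : EuclideanSpace ℝ (Fin 3)) :
    cylRadius x * ((k : ℝ) ^ 2 * (cylRadius x ^ (2 * k - 3) * S x ^ (2 * k) +
        2 * cylRadius x ^ (2 * k - 1) * S x ^ (2 * k - 1) * radDerivQuot S x +
        cylRadius x ^ (2 * k - 1) * S x ^ (2 * k - 2) * ‖fderiv ℝ S x‖ ^ 2)) =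
      ‖fderiv ℝ (fun y => cylRadius y ^ k * S y ^ k) x‖ ^ 2 := by
  have hSd : Differentiable ℝ S := hS.differentiable two_ne_zero
  obtain ⟨m, rfl⟩ : ∃ m, k = m + 3 := ⟨k - 3, by omega⟩
  have n1 : 2 * (m + 3) - 1 = 2 * m + 5 := by omega
  have n2 : 2 * (m + 3) - 2 = 2 * m + 4 := by omega
  have n3 : 2 * (m + 3) - 3 = 2 * m + 3 := by omega
  have n0 : 2 * (m + 3) = 2 * m + 6 := by omega
  simp only [n1, n2, n3]
  simp only [n0]
  push_cast
  rw [show 2 * cylRadius x ^ (2 * m + 5) * S x ^ (2 * m + 5) * radDerivQuot S x =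
      2 * cylRadius x ^ (2 * m + 3) * S x ^ (2 * m + 5) *
        (x 0 * fderiv ℝ S x (EuclideanSpace.single 0 1) + x 1 * fderiv ℝ S x (EuclideanSpace.single 1 1)) by
    rw [horizontal_inner_fderiv_eq_cylRadius_sq_mul_radDerivQuot hS hax x]; ring]
  have hQd : Differentiable ℝ fun y => S y ^ (m + 3) := fun y => (hSd y).pow _
  have hderiv : ∀ v, fderiv ℝ (fun y => cylRadius y ^ (m + 3) * S y ^ (m + 3)) x v =
      ((m : ℝ) + 3) * cylRadius x ^ (m + 1) * (x 0 * v 0 + x 1 * v 1) * S x ^ (m + 3) +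
        cylRadius x ^ (m + 3) * (((m : ℝ) + 3) * S x ^ (m + 2) * fderiv ℝ S x v) := by
    intro v
    rw [fderiv_fun_mul (differentiable_cylRadius_pow (by omega) x) (hQd x)]
    simp only [_root_.add_apply, _root_.smul_apply, smul_eq_mul,
      fderiv_cylRadius_pow_apply (n := m + 3) (by omega) x v, fderiv_pow_apply' hSd (m + 3) x v,
      show m + 3 - 2 = m + 1 by omega, show m + 3 - 1 = m + 2 by omega]
    push_cast
    ring
  rw [norm_sq_eq_sum_sq_single (fderiv ℝ (fun y => cylRadius y ^ (m + 3) * S y ^ (m + 3)) x),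
    Fin.sum_univ_three, hderiv, hderiv, hderiv, norm_sq_eq_sum_sq_single (fderiv ℝ S x),
    Fin.sum_univ_three]
  have e00 : (EuclideanSpace.single (0 : Fin 3) (1 : ℝ)) 0 = 1 := by simp
  have e01 : (EuclideanSpace.single (0 : Fin 3) (1 : ℝ)) 1 = 0 := by simp
  have e10 : (EuclideanSpace.single (1 : Fin 3) (1 : ℝ)) 0 = 0 := by simp
  have e11 : (EuclideanSpace.single (1 : Fin 3) (1 : ℝ)) 1 = 1 := by simp
  have e20 : (EuclideanSpace.single (2 : Fin 3) (1 : ℝ)) 0 = 0 := by simp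
  have e21 : (EuclideanSpace.single (2 : Fin 3) (1 : ℝ)) 1 = 0 := by simp
  rw [e00, e01, e10, e11, e20, e21]
  have hr2 : cylRadius x ^ 2 = x 0 ^ 2 + x 1 ^ 2 := cylRadius_sq x
  linear_combination (((m : ℝ) + 3) ^ 2 * S x ^ (2 * m + 6) * cylRadius x ^ (2 * m + 2)) * hr2

end DissipationDensity

/-! ### The fixed-time inequality -/

section Slice

variable {S S' : EuclideanSpace ℝ (Fin 3) → ℝ}
  {b : EuclideanSpace ℝ (Fin 3) → EuclideanSpace ℝ (Fin 3)} {ν F L B B' : ℝ} {k m : ℕ}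

/-! #### Generic domination lemmas: (bounded continuous factor) × (`L¹` factor) -/

/-- A continuous function bounded by `C` times an integrable one is integrable. [folklore] -/
private theorem integrable_bdd_mul' {f g : EuclideanSpace ℝ (Fin 3) → ℝ} (C : ℝ) (hf : Continuous f)
    (hC : ∀ x, |f x| ≤ C) (hg : Integrable g) : Integrable fun x => f x * g x :=
  hg.bdd_mul hf.aestronglyMeasurable (ae_of_all _ fun x => by rw [Real.norm_eq_abs]; exact hC x)

/-- `|rS|ⁿ ≤ Lⁿ` when `r|S| ≤ L`. [folklore] -/
private theorem abs_cylRadius_mul_pow_le (hSL : ∀ x, cylRadius x * |S x| ≤ L) (n : ℕ)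
    (x : EuclideanSpace ℝ (Fin 3)) : |cylRadius x * S x| ^ n ≤ L ^ n := by
  have h1 : |cylRadius x * S x| ≤ L := by
    rw [abs_mul, abs_of_nonneg (cylRadius_nonneg x)]; exact hSL x
  exact pow_le_pow_left₀ (abs_nonneg _) h1 n

/-- Pattern 1: `C (rS)ⁿ · g` is integrable for `g ∈ L¹`. [folklore] -/
private theorem integrable_pat1 (hSc : Continuous S) (hSL : ∀ x, cylRadius x * |S x| ≤ L)
    {g : EuclideanSpace ℝ (Fin 3) → ℝ} (hg : Integrable g) (C : ℝ) (n : ℕ) :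
    Integrable fun x => C * (cylRadius x * S x) ^ n * g x :=
  integrable_bdd_mul' (|C| * L ^ n) (continuous_const.mul ((continuous_cylRadius.mul hSc).pow n))
    (fun x => by
      rw [abs_mul, abs_pow]
      exact mul_le_mul_of_nonneg_left (abs_cylRadius_mul_pow_le hSL n x) (abs_nonneg C)) hg

/-- Pattern 2: `C (rS)ⁿ S · g` is integrable for `g ∈ L¹` (`|S| ≤ F`). [folklore] -/
private theorem integrable_pat2 (hSc : Continuous S) (hSF : ∀ x, |S x| ≤ F)
    (hSL : ∀ x, cylRadius x * |S x| ≤ L) {g : EuclideanSpace ℝ (Fin 3) → ℝ} (hg : Integrable g)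
    (C : ℝ) (n : ℕ) : Integrable fun x => C * (cylRadius x * S x) ^ n * S x * g x := by
  have hL0 : 0 ≤ L := (mul_nonneg (cylRadius_nonneg _) (abs_nonneg _)).trans (hSL 0)
  refine integrable_bdd_mul' (|C| * L ^ n * F)
    ((continuous_const.mul ((continuous_cylRadius.mul hSc).pow n)).mul hSc) (fun x => ?_) hg
  rw [abs_mul, abs_mul, abs_pow]
  exact mul_le_mul (mul_le_mul_of_nonneg_left (abs_cylRadius_mul_pow_le hSL n x) (abs_nonneg C))
    (hSF x) (abs_nonneg _) (by positivity)

/-- Pattern 3: `C rⁿ w S^{n+1} · g` is integrable for `g ∈ L¹` when `|w| ≤ r`. [folklore] -/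
private theorem integrable_pat3 (hSc : Continuous S) (hSL : ∀ x, cylRadius x * |S x| ≤ L)
    {w : EuclideanSpace ℝ (Fin 3) → ℝ} (hw : Continuous w) (hwr : ∀ x, |w x| ≤ cylRadius x)
    {g : EuclideanSpace ℝ (Fin 3) → ℝ} (hg : Integrable g) (C : ℝ) (n : ℕ) :
    Integrable fun x => C * cylRadius x ^ n * w x * S x ^ (n + 1) * g x := by
  refine integrable_bdd_mul' (|C| * L ^ (n + 1))
    (((continuous_const.mul (continuous_cylRadius.pow n)).mul hw).mul (hSc.pow _)) (fun x => ?_) hg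
  have hr := cylRadius_nonneg x
  calc |C * cylRadius x ^ n * w x * S x ^ (n + 1)|
      = |C| * (cylRadius x ^ n * |w x| * |S x| ^ (n + 1)) := by
        rw [abs_mul, abs_mul, abs_mul, abs_pow, abs_pow, abs_of_nonneg hr]; ring
    _ ≤ |C| * (cylRadius x ^ n * cylRadius x * |S x| ^ (n + 1)) :=
        mul_le_mul_of_nonneg_left (mul_le_mul_of_nonneg_right
          (mul_le_mul_of_nonneg_left (hwr x) (pow_nonneg hr _)) (pow_nonneg (abs_nonneg _) _))
          (abs_nonneg C)
    _ = |C| * |cylRadius x * S x| ^ (n + 1) := by rw [abs_mul, abs_of_nonneg hr]; ring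
    _ ≤ |C| * L ^ (n + 1) := mul_le_mul_of_nonneg_left (abs_cylRadius_mul_pow_le hSL _ x) (abs_nonneg C)

/-- Pattern 4: `C rⁿ w² S^{n+3} · g` is integrable for `g ∈ L¹` when `|w| ≤ r`, `|S| ≤ F`. [folklore] -/
private theorem integrable_pat4 (hSc : Continuous S) (hSF : ∀ x, |S x| ≤ F)
    (hSL : ∀ x, cylRadius x * |S x| ≤ L) {w : EuclideanSpace ℝ (Fin 3) → ℝ} (hw : Continuous w)
    (hwr : ∀ x, |w x| ≤ cylRadius x) {g : EuclideanSpace ℝ (Fin 3) → ℝ} (hg : Integrable g) (C : ℝ)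
    (n : ℕ) : Integrable fun x => C * cylRadius x ^ n * (w x * w x) * S x ^ (n + 3) * g x := by
  have hL0 : 0 ≤ L := (mul_nonneg (cylRadius_nonneg _) (abs_nonneg _)).trans (hSL 0)
  refine integrable_bdd_mul' (|C| * (L ^ (n + 2) * F))
    (((continuous_const.mul (continuous_cylRadius.pow n)).mul (hw.mul hw)).mul (hSc.pow _))
    (fun x => ?_) hg
  have hr := cylRadius_nonneg x
  have hww : |w x| * |w x| ≤ cylRadius x * cylRadius x := mul_le_mul (hwr x) (hwr x) (abs_nonneg _) hr
  calc |C * cylRadius x ^ n * (w x * w x) * S x ^ (n + 3)|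
      = |C| * (cylRadius x ^ n * (|w x| * |w x|) * |S x| ^ (n + 2) * |S x|) := by
        rw [abs_mul, abs_mul, abs_mul, abs_mul, abs_pow, abs_pow, abs_of_nonneg hr]; ring
    _ ≤ |C| * (cylRadius x ^ n * (cylRadius x * cylRadius x) * |S x| ^ (n + 2) * F) := by
        refine mul_le_mul_of_nonneg_left ?_ (abs_nonneg C)
        refine mul_le_mul ?_ (hSF x) (abs_nonneg _) (by positivity)
        exact mul_le_mul_of_nonneg_right (mul_le_mul_of_nonneg_left hww (pow_nonneg hr _))
          (pow_nonneg (abs_nonneg _) _)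
    _ = |C| * (|cylRadius x * S x| ^ (n + 2) * F) := by rw [abs_mul, abs_of_nonneg hr]; ring
    _ ≤ |C| * (L ^ (n + 2) * F) := by
        refine mul_le_mul_of_nonneg_left ?_ (abs_nonneg C)
        exact mul_le_mul_of_nonneg_right (abs_cylRadius_mul_pow_le hSL _ x) ((abs_nonneg _).trans (hSF x))

/-- `|x₀(eᵢ)₀ + x₁(eᵢ)₁| ≤ r` for the standard basis vectors `eᵢ`. [folklore] -/
private theorem abs_horizontal_inner_single_le (i : Fin 3) (x : EuclideanSpace ℝ (Fin 3)) :
    |x 0 * (EuclideanSpace.single i (1 : ℝ)) 0 + x 1 * (EuclideanSpace.single i (1 : ℝ)) 1| ≤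
      cylRadius x := by
  fin_cases i
  · simpa using (abs_apply_le_cylRadius x).1
  · simpa using (abs_apply_le_cylRadius x).2
  · simpa using cylRadius_nonneg x

/-! #### (E2) The transport term: `∫ 2κ r^{2m+5} S^{2m+5} DS[b] = −(2m+5) ∫ r^{2m+3}(x·b) S^{2m+6}` -/

/-- The transport term of the `L^{2m+6}(Ω)` balance, integrated by parts against the
divergence-free drift (`∫ r^{2m+5} D(S^{2m+6})[b] = −∫ D(r^{2m+5})[b] S^{2m+6}`). [folklore] -/
private theorem transport_aux (hS : ContDiff ℝ 2 S) (hSL : ∀ x, cylRadius x * |S x| ≤ L)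
    (m0 : MemLp S 2 volume)
    (m1 : ∀ i : Fin 3, MemLp (fun x => fderiv ℝ S x (EuclideanSpace.single i 1)) 2 volume)
    (mG : MemLp (fun x => cylRadius x * S x) 2 volume)
    (hb : ContDiff ℝ 1 b) (hdiv : VectorCalculus.IsDivFree b) (hbB : ∀ x, ‖b x‖ ≤ B)
    (hDb : ∀ x, ‖fderiv ℝ b x‖ ≤ B') (m : ℕ) :
    ∫ x, 2 * ((m : ℝ) + 3) * cylRadius x ^ (2 * m + 5) * S x ^ (2 * m + 5) * fderiv ℝ S x (b x) =
      -((2 * m + 5 : ℝ) * ∫ x, cylRadius x ^ (2 * m + 3) * (x 0 * b x 0 + x 1 * b x 1) *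
        S x ^ (2 * m + 6)) := by
  set e : Fin 3 → EuclideanSpace ℝ (Fin 3) := fun i => EuclideanSpace.single i 1 with he
  have hSd : Differentiable ℝ S := hS.differentiable two_ne_zero
  have hS1 : ContDiff ℝ 1 S := hS.of_le (by norm_num)
  have hSc : Continuous S := hS.continuous
  have hxc : ∀ i : Fin 3, Continuous fun x : EuclideanSpace ℝ (Fin 3) => x i := fun i =>
    (contDiff_piLp_apply (𝕜 := ℝ) (p := 2) (n := 0) (i := i)).continuous
  have iGS : Integrable fun x => cylRadius x * S x * S x := mG.integrable_mul m0
  have iSS : Integrable fun x => S x * S x := m0.integrable_mul m0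
  have iGD : ∀ i, Integrable fun x => cylRadius x * S x * fderiv ℝ S x (e i) := fun i =>
    mG.integrable_mul (m1 i)
  have hφ1 : ContDiff ℝ 1 fun y : EuclideanSpace ℝ (Fin 3) => cylRadius y ^ (2 * m + 5) :=
    contDiff_one_cylRadius_pow (by omega)
  have hφD : ∀ x v : EuclideanSpace ℝ (Fin 3), fderiv ℝ (fun y => cylRadius y ^ (2 * m + 5)) x v =
      (2 * m + 5 : ℝ) * cylRadius x ^ (2 * m + 3) * (x 0 * v 0 + x 1 * v 1) := by
    intro x v
    rw [fderiv_cylRadius_pow_apply (n := 2 * m + 5) (by omega) x v,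
      show 2 * m + 5 - 2 = 2 * m + 3 by omega]
    push_cast; ring
  -- integrability inputs
  have hab : Integrable fun x => cylRadius x ^ (2 * m + 5) * S x ^ (2 * m + 6) := by
    refine (integrable_pat1 hSc hSL iGS 1 (2 * m + 4)).congr (ae_of_all _ fun x => ?_)
    simp only; ring
  have hDab : ∀ i : Fin 3, Integrable fun x =>
      fderiv ℝ (fun y => cylRadius y ^ (2 * m + 5)) x (e i) * S x ^ (2 * m + 6) := by
    intro i
    have hw : Continuous fun x : EuclideanSpace ℝ (Fin 3) => x 0 * (e i) 0 + x 1 * (e i) 1 :=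
      ((hxc 0).mul continuous_const).add ((hxc 1).mul continuous_const)
    refine (integrable_pat3 hSc hSL hw (abs_horizontal_inner_single_le i) iSS (2 * m + 5 : ℝ)
      (2 * m + 3)).congr (ae_of_all _ fun x => ?_)
    simp only [hφD x (e i)]; ring
  have haDb : ∀ i : Fin 3, Integrable fun x =>
      cylRadius x ^ (2 * m + 5) * fderiv ℝ (fun y => S y ^ (2 * m + 6)) x (e i) := by
    intro i
    refine (integrable_pat1 hSc hSL (iGD i) (2 * m + 6 : ℝ) (2 * m + 4)).congr (ae_of_all _ fun x => ?_)
    simp only [fderiv_pow_apply' hSd (2 * m + 6) x (e i), show 2 * m + 6 - 1 = 2 * m + 5 by omega]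
    push_cast; ring
  have hIBP := integral_mul_fderiv_apply_eq_neg_of_isDivFree' (a := fun y => cylRadius y ^ (2 * m + 5))
    (b := fun y => S y ^ (2 * m + 6)) hφ1 (hS1.pow _) hb hdiv hbB hDb hab hDab haDb
  have hlhs : ∫ x, 2 * ((m : ℝ) + 3) * cylRadius x ^ (2 * m + 5) * S x ^ (2 * m + 5) *
      fderiv ℝ S x (b x) =
      ∫ x, cylRadius x ^ (2 * m + 5) * fderiv ℝ (fun y => S y ^ (2 * m + 6)) x (b x) := by
    refine integral_congr_ae (ae_of_all _ fun x => ?_)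
    simp only [fderiv_pow_apply' hSd (2 * m + 6) x (b x), show 2 * m + 6 - 1 = 2 * m + 5 by omega]
    push_cast
    ring
  have hrhs : ∫ x, fderiv ℝ (fun y => cylRadius y ^ (2 * m + 5)) x (b x) * S x ^ (2 * m + 6) =
      (2 * m + 5 : ℝ) * ∫ x, cylRadius x ^ (2 * m + 3) * (x 0 * b x 0 + x 1 * b x 1) * S x ^ (2 * m + 6) := by
    rw [← integral_const_mul]
    refine integral_congr_ae (ae_of_all _ fun x => ?_)
    simp only [hφD x (b x)]; ring
  rw [hlhs, hIBP, hrhs]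

/-! #### (E3) The diffusion term in one coordinate direction -/

/-- `∫ P ∂ᵢ∂ᵢS = −∫ ∂ᵢP ∂ᵢS` for `P = 2κ r^{2m+5} S^{2m+5}`, with `∂ᵢP` expanded. [folklore] -/
private theorem diffusion_aux (hS : ContDiff ℝ 2 S) (hSF : ∀ x, |S x| ≤ F)
    (hSL : ∀ x, cylRadius x * |S x| ≤ L) (m0 : MemLp S 2 volume) (i : Fin 3)
    (m1 : MemLp (fun x => fderiv ℝ S x (EuclideanSpace.single i 1)) 2 volume)
    (m2 : MemLp (fun x => fderiv ℝ (fun y => fderiv ℝ S y (EuclideanSpace.single i 1)) x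
      (EuclideanSpace.single i 1)) 2 volume)
    (mG : MemLp (fun x => cylRadius x * S x) 2 volume)
    (mGD : MemLp (fun x => cylRadius x * fderiv ℝ S x (EuclideanSpace.single i 1)) 2 volume)
    (m : ℕ) (κ : ℝ) :
    ∫ x, 2 * κ * cylRadius x ^ (2 * m + 5) * S x ^ (2 * m + 5) *
      fderiv ℝ (fun y => fderiv ℝ S y (EuclideanSpace.single i 1)) x (EuclideanSpace.single i 1) =
      -(2 * κ * (2 * m + 5) * ((∫ x, cylRadius x ^ (2 * m + 3) *
          (x 0 * (EuclideanSpace.single i (1:ℝ)) 0 + x 1 * (EuclideanSpace.single i (1:ℝ)) 1) *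
          S x ^ (2 * m + 5) * fderiv ℝ S x (EuclideanSpace.single i 1)) +
        ∫ x, cylRadius x ^ (2 * m + 5) * S x ^ (2 * m + 4) *
          (fderiv ℝ S x (EuclideanSpace.single i 1) * fderiv ℝ S x (EuclideanSpace.single i 1)))) := by
  set ei : EuclideanSpace ℝ (Fin 3) := EuclideanSpace.single i 1 with hei
  have hSd : Differentiable ℝ S := hS.differentiable two_ne_zero
  have hSc : Continuous S := hS.continuous
  have hxc : ∀ j : Fin 3, Continuous fun x : EuclideanSpace ℝ (Fin 3) => x j := fun j =>
    (contDiff_piLp_apply (𝕜 := ℝ) (p := 2) (n := 0) (i := j)).continuous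
  have hDSd : Differentiable ℝ fun x => fderiv ℝ S x ei :=
    (contDiff_fderiv_apply_const_succ (n := 1) (by exact_mod_cast hS) ei).differentiable one_ne_zero
  have hRd : Differentiable ℝ fun y : EuclideanSpace ℝ (Fin 3) => cylRadius y ^ (2 * m + 5) :=
    differentiable_cylRadius_pow (by omega)
  have hφD : ∀ x v : EuclideanSpace ℝ (Fin 3), fderiv ℝ (fun y => cylRadius y ^ (2 * m + 5)) x v =
      (2 * m + 5 : ℝ) * cylRadius x ^ (2 * m + 3) * (x 0 * v 0 + x 1 * v 1) := by
    intro x v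
    rw [fderiv_cylRadius_pow_apply (n := 2 * m + 5) (by omega) x v,
      show 2 * m + 5 - 2 = 2 * m + 3 by omega]
    push_cast; ring
  -- `L¹` products
  have iSD : Integrable fun x => S x * fderiv ℝ S x ei := m0.integrable_mul m1
  have iGD : Integrable fun x => cylRadius x * S x * fderiv ℝ S x ei := mG.integrable_mul m1
  have iGD2 : Integrable fun x => cylRadius x * S x * fderiv ℝ (fun y => fderiv ℝ S y ei) x ei :=
    mG.integrable_mul m2
  have iRD : Integrable fun x => (cylRadius x * fderiv ℝ S x ei) * (cylRadius x * fderiv ℝ S x ei) :=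
    mGD.integrable_mul mGD
  -- `P` and `∂ᵢP`
  have hPd : Differentiable ℝ fun y => 2 * κ * cylRadius y ^ (2 * m + 5) * S y ^ (2 * m + 5) :=
    (hRd.const_mul (2 * κ)).mul (hSd.pow _)
  have dP : ∀ x v : EuclideanSpace ℝ (Fin 3),
      fderiv ℝ (fun y => 2 * κ * cylRadius y ^ (2 * m + 5) * S y ^ (2 * m + 5)) x v =
        2 * κ * ((2 * m + 5 : ℝ) * cylRadius x ^ (2 * m + 3) * (x 0 * v 0 + x 1 * v 1) * S x ^ (2 * m + 5) +
          cylRadius x ^ (2 * m + 5) * ((2 * m + 5 : ℝ) * S x ^ (2 * m + 4) * fderiv ℝ S x v)) := by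
    intro x v
    have h1 : HasFDerivAt (fun y => 2 * κ * cylRadius y ^ (2 * m + 5))
        ((2 * κ) • fderiv ℝ (fun y => cylRadius y ^ (2 * m + 5)) x) x :=
      ((hRd x).hasFDerivAt).const_mul (2 * κ)
    have h2 : HasFDerivAt (fun y => S y ^ (2 * m + 5)) (fderiv ℝ (fun y => S y ^ (2 * m + 5)) x) x :=
      ((hSd.pow _) x).hasFDerivAt
    rw [(h1.fun_mul h2).fderiv]
    simp only [_root_.add_apply, _root_.smul_apply, smul_eq_mul, hφD x v,
      fderiv_pow_apply' hSd (2 * m + 5) x v, show 2 * m + 5 - 1 = 2 * m + 4 by omega]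
    push_cast
    ring
  -- the two pieces of `∂ᵢP ∂ᵢS`
  have hw : Continuous fun x : EuclideanSpace ℝ (Fin 3) => x 0 * ei 0 + x 1 * ei 1 :=
    ((hxc 0).mul continuous_const).add ((hxc 1).mul continuous_const)
  have iA : Integrable fun x => cylRadius x ^ (2 * m + 3) * (x 0 * ei 0 + x 1 * ei 1) *
      S x ^ (2 * m + 5) * fderiv ℝ S x ei := by
    refine (integrable_pat3 hSc hSL hw (abs_horizontal_inner_single_le i) iSD 1 (2 * m + 3)).congr
      (ae_of_all _ fun x => ?_)
    simp only; ring
  have iB : Integrable fun x => cylRadius x ^ (2 * m + 5) * S x ^ (2 * m + 4) *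
      (fderiv ℝ S x ei * fderiv ℝ S x ei) := by
    refine (integrable_pat2 hSc hSF hSL iRD 1 (2 * m + 3)).congr (ae_of_all _ fun x => ?_)
    simp only; ring
  have h1 : Integrable fun x => fderiv ℝ (fun y => 2 * κ * cylRadius y ^ (2 * m + 5) *
      S y ^ (2 * m + 5)) x ei * fderiv ℝ S x ei := by
    have hsum : Integrable fun x => 2 * κ * (2 * m + 5) * (cylRadius x ^ (2 * m + 3) *
        (x 0 * ei 0 + x 1 * ei 1) * S x ^ (2 * m + 5) * fderiv ℝ S x ei) +
        2 * κ * (2 * m + 5) * (cylRadius x ^ (2 * m + 5) * S x ^ (2 * m + 4) *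
          (fderiv ℝ S x ei * fderiv ℝ S x ei)) :=
      (iA.const_mul (2 * κ * (2 * m + 5))).add (iB.const_mul (2 * κ * (2 * m + 5)))
    refine hsum.congr (ae_of_all _ fun x => ?_)
    simp only [dP x ei]; ring
  have h2 : Integrable fun x => 2 * κ * cylRadius x ^ (2 * m + 5) * S x ^ (2 * m + 5) *
      fderiv ℝ (fun y => fderiv ℝ S y ei) x ei := by
    refine (integrable_pat1 hSc hSL iGD2 (2 * κ) (2 * m + 4)).congr (ae_of_all _ fun x => ?_)
    simp only; ring
  have h3 : Integrable fun x => 2 * κ * cylRadius x ^ (2 * m + 5) * S x ^ (2 * m + 5) *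
      fderiv ℝ S x ei := by
    refine (integrable_pat1 hSc hSL iGD (2 * κ) (2 * m + 4)).congr (ae_of_all _ fun x => ?_)
    simp only; ring
  rw [integral_mul_fderiv_eq_neg_of_differentiable hPd hDSd ei h1 h2 h3]
  congr 1
  have : ∫ x, fderiv ℝ (fun y => 2 * κ * cylRadius y ^ (2 * m + 5) * S y ^ (2 * m + 5)) x ei *
      fderiv ℝ S x ei = ∫ x, (2 * κ * (2 * m + 5) * (cylRadius x ^ (2 * m + 3) *
        (x 0 * ei 0 + x 1 * ei 1) * S x ^ (2 * m + 5) * fderiv ℝ S x ei) +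
        2 * κ * (2 * m + 5) * (cylRadius x ^ (2 * m + 5) * S x ^ (2 * m + 4) *
          (fderiv ℝ S x ei * fderiv ℝ S x ei))) :=
    integral_congr_ae (ae_of_all _ fun x => by simp only [dP x ei]; ring)
  have iA' : Integrable fun x => 2 * κ * (2 * m + 5) * (cylRadius x ^ (2 * m + 3) *
      (x 0 * ei 0 + x 1 * ei 1) * S x ^ (2 * m + 5) * fderiv ℝ S x ei) := iA.const_mul _
  have iB' : Integrable fun x => 2 * κ * (2 * m + 5) * (cylRadius x ^ (2 * m + 5) * S x ^ (2 * m + 4) *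
      (fderiv ℝ S x ei * fderiv ℝ S x ei)) := iB.const_mul _
  rw [this, integral_add iA' iB', integral_const_mul, integral_const_mul]
  ring

/-! #### (E5) The radial integration by parts `∫ r^{2m+3} xᵢ ∂ᵢ(S^{2m+6})` -/

/-- The integrand `((2m+3) r^{2m+1} xᵢ² + r^{2m+3}) S^{2m+6}` is integrable (`i = 0, 1`). [folklore] -/
private theorem integrable_radial_aux (hSc : Continuous S) (hSF : ∀ x, |S x| ≤ F)
    (hSL : ∀ x, cylRadius x * |S x| ≤ L) (m0 : MemLp S 2 volume) (i : Fin 3) (hi : i = 0 ∨ i = 1)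
    (m : ℕ) : Integrable fun x => ((2 * m + 3 : ℝ) * cylRadius x ^ (2 * m + 1) * (x i * x i) +
      cylRadius x ^ (2 * m + 3)) * S x ^ (2 * m + 6) := by
  have hxi : ∀ x : EuclideanSpace ℝ (Fin 3), |x i| ≤ cylRadius x := by
    rcases hi with rfl | rfl
    · exact fun x => (abs_apply_le_cylRadius x).1
    · exact fun x => (abs_apply_le_cylRadius x).2
  have hxc : Continuous fun x : EuclideanSpace ℝ (Fin 3) => x i :=
    (contDiff_piLp_apply (𝕜 := ℝ) (p := 2) (n := 0) (i := i)).continuous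
  have iSS : Integrable fun x => S x * S x := m0.integrable_mul m0
  have hA := integrable_pat4 hSc hSF hSL hxc hxi iSS (2 * m + 3 : ℝ) (2 * m + 1)
  have hB := integrable_pat2 hSc hSF hSL iSS 1 (2 * m + 3)
  refine (hA.add hB).congr (ae_of_all _ fun x => ?_)
  simp only [Pi.add_apply]; ring

/-- `∫ r^{2m+3} xᵢ ∂ᵢ(S^{2m+6}) = −∫ ((2m+3) r^{2m+1} xᵢ² + r^{2m+3}) S^{2m+6}` for `i = 0, 1`
(whole-space integration by parts; the weight `r^{2m+3} xᵢ` is `C¹`). [folklore] -/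
private theorem radial_aux (hS : ContDiff ℝ 2 S) (hSF : ∀ x, |S x| ≤ F)
    (hSL : ∀ x, cylRadius x * |S x| ≤ L) (m0 : MemLp S 2 volume) (i : Fin 3) (hi : i = 0 ∨ i = 1)
    (m1 : MemLp (fun x => fderiv ℝ S x (EuclideanSpace.single i 1)) 2 volume) (m : ℕ) :
    ∫ x, cylRadius x ^ (2 * m + 3) * x i * fderiv ℝ (fun y => S y ^ (2 * m + 6)) x
      (EuclideanSpace.single i 1) =
      -∫ x, ((2 * m + 3 : ℝ) * cylRadius x ^ (2 * m + 1) * (x i * x i) + cylRadius x ^ (2 * m + 3)) *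
        S x ^ (2 * m + 6) := by
  set ei : EuclideanSpace ℝ (Fin 3) := EuclideanSpace.single i 1 with hei
  have hSd : Differentiable ℝ S := hS.differentiable two_ne_zero
  have hSc : Continuous S := hS.continuous
  have hxi : ∀ x : EuclideanSpace ℝ (Fin 3), |x i| ≤ cylRadius x := by
    rcases hi with rfl | rfl
    · exact fun x => (abs_apply_le_cylRadius x).1
    · exact fun x => (abs_apply_le_cylRadius x).2
  have hxc : Continuous fun x : EuclideanSpace ℝ (Fin 3) => x i :=
    (contDiff_piLp_apply (𝕜 := ℝ) (p := 2) (n := 0) (i := i)).continuous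
  have hxid : Differentiable ℝ fun y : EuclideanSpace ℝ (Fin 3) => y i := fun y =>
    (EuclideanSpace.proj i : EuclideanSpace ℝ (Fin 3) →L[ℝ] ℝ).differentiableAt
  have hxiD : ∀ y : EuclideanSpace ℝ (Fin 3), fderiv ℝ (fun y : EuclideanSpace ℝ (Fin 3) => y i) y ei = 1 := by
    intro y
    rw [show (fun y : EuclideanSpace ℝ (Fin 3) => y i) =
      fun y => (EuclideanSpace.proj i : EuclideanSpace ℝ (Fin 3) →L[ℝ] ℝ) y from rfl,
      ContinuousLinearMap.fderiv]
    simp [hei]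
  have hei_i : ∀ x : EuclideanSpace ℝ (Fin 3), x 0 * ei 0 + x 1 * ei 1 = x i := by
    intro x
    rcases hi with rfl | rfl <;> simp [hei]
  have hRd : Differentiable ℝ fun y : EuclideanSpace ℝ (Fin 3) => cylRadius y ^ (2 * m + 3) :=
    differentiable_cylRadius_pow (by omega)
  have hVd : Differentiable ℝ fun y : EuclideanSpace ℝ (Fin 3) => cylRadius y ^ (2 * m + 3) * y i :=
    hRd.mul hxid
  have dV : ∀ x, fderiv ℝ (fun y : EuclideanSpace ℝ (Fin 3) => cylRadius y ^ (2 * m + 3) * y i) x ei =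
      (2 * m + 3 : ℝ) * cylRadius x ^ (2 * m + 1) * (x i * x i) + cylRadius x ^ (2 * m + 3) := by
    intro x
    rw [fderiv_fun_mul (hRd x) (hxid x)]
    simp only [_root_.add_apply, _root_.smul_apply, smul_eq_mul, hxiD x,
      fderiv_cylRadius_pow_apply (n := 2 * m + 3) (by omega) x ei,
      show 2 * m + 3 - 2 = 2 * m + 1 by omega, hei_i x]
    push_cast
    ring
  have iSS : Integrable fun x => S x * S x := m0.integrable_mul m0
  have iSD : Integrable fun x => S x * fderiv ℝ S x ei := m0.integrable_mul m1
  have h1 : Integrable fun x => fderiv ℝ (fun y : EuclideanSpace ℝ (Fin 3) =>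
      cylRadius y ^ (2 * m + 3) * y i) x ei * S x ^ (2 * m + 6) := by
    refine (integrable_radial_aux hSc hSF hSL m0 i hi m).congr (ae_of_all _ fun x => ?_)
    simp only [dV x]
  have h2 : Integrable fun x => cylRadius x ^ (2 * m + 3) * x i *
      fderiv ℝ (fun y => S y ^ (2 * m + 6)) x ei := by
    refine (integrable_pat3 hSc hSL hxc hxi iSD (2 * m + 6 : ℝ) (2 * m + 3)).congr
      (ae_of_all _ fun x => ?_)
    simp only [fderiv_pow_apply' hSd (2 * m + 6) x ei, show 2 * m + 6 - 1 = 2 * m + 5 by omega]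
    push_cast; ring
  have h3 : Integrable fun x => cylRadius x ^ (2 * m + 3) * x i * S x ^ (2 * m + 6) := by
    refine (integrable_pat3 hSc hSL hxc hxi iSS 1 (2 * m + 3)).congr (ae_of_all _ fun x => ?_)
    simp only; ring
  have hQd : Differentiable ℝ fun y => S y ^ (2 * m + 6) := fun x => (hSd x).pow _
  rw [integral_mul_fderiv_eq_neg_of_differentiable hVd hQd ei h1 h2 h3]
  congr 1
  exact integral_congr_ae (ae_of_all _ fun x => by simp only [dV x])

/-! #### The fixed-time inequality, assembled -/

/-- **The `L^{2k}(Ω, dr dz)` balance of `ω_θ = r S` with its dissipation, at a fixed time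
(`k ≥ 3`).** For an axisymmetric scalar `S ∈ C²` with `|S| ≤ F`, `r|S| ≤ L`,
`S, ∂ᵢS, ∂ᵢ∂ᵢS, (∂ᵣS)/r, rS, r∂ᵢS ∈ L²`, a bounded divergence-free drift `b ∈ C¹` with bounded
derivative, `ν ≥ 0` and the swirl-free `η`-equation `S' + DS[b] = ν(ΔS + 2(∂ᵣS)/r)` (so that
`S'` is determined pointwise):
`∫ 2k r^{2k−1} S^{2k−1} S' + ν·2(2k−1)k ∫ (r^{2k−3}S^{2k} + 2 r^{2k−1}S^{2k−1}(∂ᵣS)/r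
+ r^{2k−1}S^{2k−2}‖DS‖²) ≤ (2k−1) ∫ r^{2k−3}(x₀b₀ + x₁b₁) S^{2k}`, where `r·k²(…) = ‖D(r^k S^k)‖²`
(`cylRadius_mul_sq_mul_dissipDensity_eq_norm_fderiv_sq`). In `Ω`-variables (`ω_θ = rS`,
`dx = 2π r dr dz`, `p = 2k`): `d/dt ∫_Ω ω_θ^p + (4(p−1)/p) ∫_Ω |∇(ω_θ^{p/2})|² ≤ (p−1)∫_Ω (u_r/r) ω_θ^p`
— (5.8) of Gallay–Šverák for the exponent `p` (transport `(p−1)∫(u_r/r)ω_θ^p` since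
`div_*(u) = −u_r/r`, diffusion `−p(p−1)∫ω_θ^{p−2}|∇ω_θ|² = −(4(p−1)/p)∫|∇ω_θ^{p/2}|²` as in
Feng–Šverák, and the zeroth-order term `−(p−1)∫_Ω ω_θ^p/r² ≤ 0` dropped).
[cite: GallaySverak2016, proof of Prop. 5.3, (5.8) (arXiv p. 16); FengSverak2015, proof of
Lemma 3.8 (arXiv p. 12)] -/
theorem integral_weight_pow_mul_deriv_add_dissipation_le_of_drift_laplacian (hk : 3 ≤ k)
    (hS : ContDiff ℝ 2 S) (hax : IsAxisymmetricScalar S) (hSF : ∀ x, |S x| ≤ F)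
    (hSL : ∀ x, cylRadius x * |S x| ≤ L) (m0 : MemLp S 2 volume)
    (m1 : ∀ i : Fin 3, MemLp (fun x => fderiv ℝ S x (EuclideanSpace.single i 1)) 2 volume)
    (m2 : ∀ i : Fin 3, MemLp (fun x => fderiv ℝ (fun y => fderiv ℝ S y (EuclideanSpace.single i 1)) x
      (EuclideanSpace.single i 1)) 2 volume)
    (mq : MemLp (radDerivQuot S) 2 volume) (mG : MemLp (fun x => cylRadius x * S x) 2 volume)
    (mGD : ∀ i : Fin 3,
      MemLp (fun x => cylRadius x * fderiv ℝ S x (EuclideanSpace.single i 1)) 2 volume)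
    (hb : ContDiff ℝ 1 b) (hdiv : VectorCalculus.IsDivFree b)
    (hbB : ∀ x, ‖b x‖ ≤ B) (hDb : ∀ x, ‖fderiv ℝ b x‖ ≤ B') (hν : 0 ≤ ν)
    (heq : ∀ x, S' x + fderiv ℝ S x (b x) = ν * ((Δ S) x + 2 * radDerivQuot S x)) :
    (∫ x, 2 * k * cylRadius x ^ (2 * k - 1) * S x ^ (2 * k - 1) * S' x) +
      ν * (2 * (2 * k - 1) * k) * ∫ x, (cylRadius x ^ (2 * k - 3) * S x ^ (2 * k) +
        2 * cylRadius x ^ (2 * k - 1) * S x ^ (2 * k - 1) * radDerivQuot S x +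
        cylRadius x ^ (2 * k - 1) * S x ^ (2 * k - 2) * ‖fderiv ℝ S x‖ ^ 2) ≤
      (2 * k - 1) * ∫ x, cylRadius x ^ (2 * k - 3) * (x 0 * b x 0 + x 1 * b x 1) * S x ^ (2 * k) := by
  -- write `k = m + 3`, so that all exponents are closed forms
  obtain ⟨m, rfl⟩ : ∃ m, k = m + 3 := ⟨k - 3, by omega⟩
  have n1 : 2 * (m + 3) - 1 = 2 * m + 5 := by omega
  have n2 : 2 * (m + 3) - 2 = 2 * m + 4 := by omega
  have n3 : 2 * (m + 3) - 3 = 2 * m + 3 := by omega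
  have n0 : 2 * (m + 3) = 2 * m + 6 := by omega
  simp only [n1, n2, n3]
  simp only [n0]
  push_cast
  -- regularity and elementary bounds
  have hSd : Differentiable ℝ S := hS.differentiable two_ne_zero
  have hSc : Continuous S := hS.continuous
  have hr0 : ∀ x : EuclideanSpace ℝ (Fin 3), 0 ≤ cylRadius x := cylRadius_nonneg
  have hxc : ∀ i : Fin 3, Continuous fun x : EuclideanSpace ℝ (Fin 3) => x i := fun i =>
    (contDiff_piLp_apply (𝕜 := ℝ) (p := 2) (n := 0) (i := i)).continuous
  have hbic : ∀ i : Fin 3, Continuous fun x => b x i := fun i =>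
    (contDiff_apply_coord_vec3 hb i).continuous
  have hx0 : ∀ x : EuclideanSpace ℝ (Fin 3), |x 0| ≤ cylRadius x := fun x => (abs_apply_le_cylRadius x).1
  have hx1 : ∀ x : EuclideanSpace ℝ (Fin 3), |x 1| ≤ cylRadius x := fun x => (abs_apply_le_cylRadius x).2
  -- basic `L¹` products (`L² × L²`)
  have iSS : Integrable fun x => S x * S x := m0.integrable_mul m0
  have iGD : ∀ i : Fin 3, Integrable fun x => cylRadius x * S x *
      fderiv ℝ S x (EuclideanSpace.single i 1) := fun i => mG.integrable_mul (m1 i)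
  have iSD : ∀ i : Fin 3, Integrable fun x => S x * fderiv ℝ S x (EuclideanSpace.single i 1) :=
    fun i => m0.integrable_mul (m1 i)
  have iGD2 : ∀ i : Fin 3, Integrable fun x => cylRadius x * S x *
      fderiv ℝ (fun y => fderiv ℝ S y (EuclideanSpace.single i 1)) x (EuclideanSpace.single i 1) :=
    fun i => mG.integrable_mul (m2 i)
  have iGq : Integrable fun x => cylRadius x * S x * radDerivQuot S x := mG.integrable_mul mq
  have iRD : ∀ i : Fin 3, Integrable fun x => (cylRadius x * fderiv ℝ S x (EuclideanSpace.single i 1)) *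
      (cylRadius x * fderiv ℝ S x (EuclideanSpace.single i 1)) := fun i => (mGD i).integrable_mul (mGD i)
  -- `P`-weighted integrands, `P = 2(m+3) r^{2m+5} S^{2m+5} = 2(m+3) (rS)^{2m+4} · (rS)`
  have iP : ∀ {g : EuclideanSpace ℝ (Fin 3) → ℝ}, Integrable (fun x => cylRadius x * S x * g x) →
      Integrable fun x => 2 * ((m : ℝ) + 3) * cylRadius x ^ (2 * m + 5) * S x ^ (2 * m + 5) * g x := by
    intro g hg
    refine (integrable_pat1 hSc hSL hg (2 * ((m : ℝ) + 3)) (2 * m + 4)).congr (ae_of_all _ fun x => ?_)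
    simp only; ring
  have iPD2 : ∀ i : Fin 3, Integrable fun x => 2 * ((m : ℝ) + 3) * cylRadius x ^ (2 * m + 5) *
      S x ^ (2 * m + 5) *
      fderiv ℝ (fun y => fderiv ℝ S y (EuclideanSpace.single i 1)) x (EuclideanSpace.single i 1) :=
    fun i => iP (iGD2 i)
  have iPq : Integrable fun x => 2 * ((m : ℝ) + 3) * cylRadius x ^ (2 * m + 5) * S x ^ (2 * m + 5) *
      radDerivQuot S x := iP iGq
  have iPDi : ∀ i : Fin 3, Integrable fun x => 2 * ((m : ℝ) + 3) * cylRadius x ^ (2 * m + 5) *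
      S x ^ (2 * m + 5) * fderiv ℝ S x (EuclideanSpace.single i 1) := fun i => iP (iGD i)
  have iPDb : Integrable fun x => 2 * ((m : ℝ) + 3) * cylRadius x ^ (2 * m + 5) * S x ^ (2 * m + 5) *
      fderiv ℝ S x (b x) := by
    have hbiB : ∀ (i : Fin 3) x, |b x i| ≤ B := fun i x => by
      have := (PiLp.norm_apply_le (b x) i).trans (hbB x)
      rwa [Real.norm_eq_abs] at this
    have iA : ∀ i : Fin 3, Integrable fun x => b x i * (2 * ((m : ℝ) + 3) * cylRadius x ^ (2 * m + 5) *
        S x ^ (2 * m + 5) * fderiv ℝ S x (EuclideanSpace.single i 1)) := fun i =>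
      integrable_bdd_mul' B (hbic i) (hbiB i) (iPDi i)
    refine (((iA 0).add (iA 1)).add (iA 2)).congr (ae_of_all _ fun x => ?_)
    simp only [Pi.add_apply]
    rw [fderiv_apply_eq_sum_three S x (b x)]
    ring
  have hlap : ∀ x, (Δ S) x =
      fderiv ℝ (fun y => fderiv ℝ S y (EuclideanSpace.single 0 1)) x (EuclideanSpace.single 0 1) +
      fderiv ℝ (fun y => fderiv ℝ S y (EuclideanSpace.single 1 1)) x (EuclideanSpace.single 1 1) +
      fderiv ℝ (fun y => fderiv ℝ S y (EuclideanSpace.single 2 1)) x (EuclideanSpace.single 2 1) := by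
    intro x
    rw [laplacian_eq_sum_fderiv_fderiv (EuclideanSpace.basisFun (Fin 3) ℝ) hS x]
    simp only [EuclideanSpace.basisFun_apply, Fin.sum_univ_three]
  have iPlap : Integrable fun x => 2 * ((m : ℝ) + 3) * cylRadius x ^ (2 * m + 5) * S x ^ (2 * m + 5) *
      (Δ S) x := by
    refine (((iPD2 0).add (iPD2 1)).add (iPD2 2)).congr (ae_of_all _ fun x => ?_)
    simp only [Pi.add_apply, hlap x]
    ring
  -- the four functionals
  set IM : ℝ := ∫ x, cylRadius x ^ (2 * m + 3) * S x ^ (2 * m + 5) *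
    (x 0 * fderiv ℝ S x (EuclideanSpace.single 0 1) + x 1 * fderiv ℝ S x (EuclideanSpace.single 1 1))
    with hIM
  set ID : ℝ := ∫ x, cylRadius x ^ (2 * m + 5) * S x ^ (2 * m + 4) * ‖fderiv ℝ S x‖ ^ 2 with hID
  set IA : ℝ := ∫ x, cylRadius x ^ (2 * m + 3) * S x ^ (2 * m + 6) with hIA
  set IT : ℝ := ∫ x, cylRadius x ^ (2 * m + 3) * (x 0 * b x 0 + x 1 * b x 1) * S x ^ (2 * m + 6)
    with hIT
  -- integrability of their pieces
  have iMi : ∀ i : Fin 3, (i = 0 ∨ i = 1) → Integrable fun x => cylRadius x ^ (2 * m + 3) *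
      S x ^ (2 * m + 5) * (x i * fderiv ℝ S x (EuclideanSpace.single i 1)) := by
    intro i hi
    have hxi : ∀ x : EuclideanSpace ℝ (Fin 3), |x i| ≤ cylRadius x := by
      rcases hi with rfl | rfl
      · exact hx0
      · exact hx1
    refine (integrable_pat3 hSc hSL (hxc i) hxi (iSD i) 1 (2 * m + 3)).congr (ae_of_all _ fun x => ?_)
    simp only; ring
  have iM : Integrable fun x => cylRadius x ^ (2 * m + 3) * S x ^ (2 * m + 5) *
      (x 0 * fderiv ℝ S x (EuclideanSpace.single 0 1) + x 1 * fderiv ℝ S x (EuclideanSpace.single 1 1)) := by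
    refine ((iMi 0 (Or.inl rfl)).add (iMi 1 (Or.inr rfl))).congr (ae_of_all _ fun x => ?_)
    simp only [Pi.add_apply]; ring
  have hIMsum : IM = (∫ x, cylRadius x ^ (2 * m + 3) * S x ^ (2 * m + 5) *
      (x 0 * fderiv ℝ S x (EuclideanSpace.single 0 1))) +
      ∫ x, cylRadius x ^ (2 * m + 3) * S x ^ (2 * m + 5) * (x 1 * fderiv ℝ S x (EuclideanSpace.single 1 1)) := by
    rw [hIM, ← integral_add (iMi 0 (Or.inl rfl)) (iMi 1 (Or.inr rfl))]
    refine integral_congr_ae (ae_of_all _ fun x => ?_)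
    beta_reduce; ring
  have iDi : ∀ i : Fin 3, Integrable fun x => cylRadius x ^ (2 * m + 5) * S x ^ (2 * m + 4) *
      (fderiv ℝ S x (EuclideanSpace.single i 1) * fderiv ℝ S x (EuclideanSpace.single i 1)) := by
    intro i
    refine (integrable_pat2 hSc hSF hSL (iRD i) 1 (2 * m + 3)).congr (ae_of_all _ fun x => ?_)
    simp only; ring
  have hnsq : ∀ x, ‖fderiv ℝ S x‖ ^ 2 =
      fderiv ℝ S x (EuclideanSpace.single 0 1) * fderiv ℝ S x (EuclideanSpace.single 0 1) +
      fderiv ℝ S x (EuclideanSpace.single 1 1) * fderiv ℝ S x (EuclideanSpace.single 1 1) +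
      fderiv ℝ S x (EuclideanSpace.single 2 1) * fderiv ℝ S x (EuclideanSpace.single 2 1) := by
    intro x
    rw [norm_sq_eq_sum_sq_single (fderiv ℝ S x), Fin.sum_univ_three]
    ring
  have iD : Integrable fun x => cylRadius x ^ (2 * m + 5) * S x ^ (2 * m + 4) * ‖fderiv ℝ S x‖ ^ 2 := by
    refine (((iDi 0).add (iDi 1)).add (iDi 2)).congr (ae_of_all _ fun x => ?_)
    simp only [Pi.add_apply, hnsq x]; ring
  have hIDsum : ID = (∫ x, cylRadius x ^ (2 * m + 5) * S x ^ (2 * m + 4) *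
      (fderiv ℝ S x (EuclideanSpace.single 0 1) * fderiv ℝ S x (EuclideanSpace.single 0 1))) +
      (∫ x, cylRadius x ^ (2 * m + 5) * S x ^ (2 * m + 4) *
        (fderiv ℝ S x (EuclideanSpace.single 1 1) * fderiv ℝ S x (EuclideanSpace.single 1 1))) +
      ∫ x, cylRadius x ^ (2 * m + 5) * S x ^ (2 * m + 4) *
        (fderiv ℝ S x (EuclideanSpace.single 2 1) * fderiv ℝ S x (EuclideanSpace.single 2 1)) := by
    have i01 : Integrable fun x => cylRadius x ^ (2 * m + 5) * S x ^ (2 * m + 4) *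
        (fderiv ℝ S x (EuclideanSpace.single 0 1) * fderiv ℝ S x (EuclideanSpace.single 0 1)) +
        cylRadius x ^ (2 * m + 5) * S x ^ (2 * m + 4) *
        (fderiv ℝ S x (EuclideanSpace.single 1 1) * fderiv ℝ S x (EuclideanSpace.single 1 1)) :=
      (iDi 0).add (iDi 1)
    rw [hID, ← integral_add (iDi 0) (iDi 1), ← integral_add i01 (iDi 2)]
    refine integral_congr_ae (ae_of_all _ fun x => ?_)
    simp only [hnsq x]; ring
  have iAint : Integrable fun x => cylRadius x ^ (2 * m + 3) * S x ^ (2 * m + 6) := by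
    refine (integrable_pat2 hSc hSF hSL iSS 1 (2 * m + 3)).congr (ae_of_all _ fun x => ?_)
    simp only; ring
  have hIA0 : 0 ≤ IA := by
    rw [hIA]
    refine integral_nonneg fun x => ?_
    have : S x ^ (2 * m + 6) = (S x ^ (m + 3)) ^ 2 := by ring
    rw [this]
    exact mul_nonneg (pow_nonneg (hr0 x) _) (sq_nonneg _)
  ------------------------------------------------------------------
  -- (E1) pair the equation with `P`: `∫ P S' = −∫ P DS[b] + ν ∫ P ΔS + 2ν ∫ P q`
  ------------------------------------------------------------------
  have hE1 : ∫ x, 2 * ((m : ℝ) + 3) * cylRadius x ^ (2 * m + 5) * S x ^ (2 * m + 5) * S' x =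
      -(∫ x, 2 * ((m : ℝ) + 3) * cylRadius x ^ (2 * m + 5) * S x ^ (2 * m + 5) * fderiv ℝ S x (b x)) +
      ν * (∫ x, 2 * ((m : ℝ) + 3) * cylRadius x ^ (2 * m + 5) * S x ^ (2 * m + 5) * (Δ S) x) +
      2 * ν * (∫ x, 2 * ((m : ℝ) + 3) * cylRadius x ^ (2 * m + 5) * S x ^ (2 * m + 5) *
        radDerivQuot S x) := by
    have hpt : ∀ x, 2 * ((m : ℝ) + 3) * cylRadius x ^ (2 * m + 5) * S x ^ (2 * m + 5) * S' x =
        -(2 * ((m : ℝ) + 3) * cylRadius x ^ (2 * m + 5) * S x ^ (2 * m + 5) * fderiv ℝ S x (b x)) +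
        ν * (2 * ((m : ℝ) + 3) * cylRadius x ^ (2 * m + 5) * S x ^ (2 * m + 5) * (Δ S) x) +
        2 * ν * (2 * ((m : ℝ) + 3) * cylRadius x ^ (2 * m + 5) * S x ^ (2 * m + 5) *
          radDerivQuot S x) := by
      intro x
      have h := heq x
      have : S' x = -fderiv ℝ S x (b x) + ν * ((Δ S) x + 2 * radDerivQuot S x) := by linarith
      rw [this]; ring
    have i1 : Integrable fun x => -(2 * ((m : ℝ) + 3) * cylRadius x ^ (2 * m + 5) * S x ^ (2 * m + 5) *
        fderiv ℝ S x (b x)) := iPDb.neg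
    have i2 : Integrable fun x => ν * (2 * ((m : ℝ) + 3) * cylRadius x ^ (2 * m + 5) *
        S x ^ (2 * m + 5) * (Δ S) x) := iPlap.const_mul ν
    have i3 : Integrable fun x => 2 * ν * (2 * ((m : ℝ) + 3) * cylRadius x ^ (2 * m + 5) *
        S x ^ (2 * m + 5) * radDerivQuot S x) := iPq.const_mul (2 * ν)
    have i12 : Integrable fun x => -(2 * ((m : ℝ) + 3) * cylRadius x ^ (2 * m + 5) * S x ^ (2 * m + 5) *
        fderiv ℝ S x (b x)) + ν * (2 * ((m : ℝ) + 3) * cylRadius x ^ (2 * m + 5) *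
        S x ^ (2 * m + 5) * (Δ S) x) := i1.add i2
    rw [integral_congr_ae (ae_of_all _ hpt), integral_add i12 i3, integral_add i1 i2,
      integral_neg, integral_const_mul, integral_const_mul]
  ------------------------------------------------------------------
  -- (E2) transport: `∫ P DS[b] = −(2m+5) I_T`
  ------------------------------------------------------------------
  have hE2 := transport_aux hS hSL m0 m1 mG hb hdiv hbB hDb m
  ------------------------------------------------------------------
  -- (E3) diffusion: `∫ P ΔS = −2(m+3)(2m+5)(I_M + I_D)`
  ------------------------------------------------------------------
  have hE3 : ∫ x, 2 * ((m : ℝ) + 3) * cylRadius x ^ (2 * m + 5) * S x ^ (2 * m + 5) * (Δ S) x =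
      -(2 * ((m : ℝ) + 3) * (2 * m + 5) * (IM + ID)) := by
    have hE3i := fun i : Fin 3 => diffusion_aux hS hSF hSL m0 i (m1 i) (m2 i) mG (mGD i) m ((m : ℝ) + 3)
    have hsum : ∫ x, 2 * ((m : ℝ) + 3) * cylRadius x ^ (2 * m + 5) * S x ^ (2 * m + 5) * (Δ S) x =
        (∫ x, 2 * ((m : ℝ) + 3) * cylRadius x ^ (2 * m + 5) * S x ^ (2 * m + 5) *
          fderiv ℝ (fun y => fderiv ℝ S y (EuclideanSpace.single 0 1)) x (EuclideanSpace.single 0 1)) +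
        (∫ x, 2 * ((m : ℝ) + 3) * cylRadius x ^ (2 * m + 5) * S x ^ (2 * m + 5) *
          fderiv ℝ (fun y => fderiv ℝ S y (EuclideanSpace.single 1 1)) x (EuclideanSpace.single 1 1)) +
        ∫ x, 2 * ((m : ℝ) + 3) * cylRadius x ^ (2 * m + 5) * S x ^ (2 * m + 5) *
          fderiv ℝ (fun y => fderiv ℝ S y (EuclideanSpace.single 2 1)) x (EuclideanSpace.single 2 1) := by
      have i01 : Integrable fun x => 2 * ((m : ℝ) + 3) * cylRadius x ^ (2 * m + 5) * S x ^ (2 * m + 5) *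
          fderiv ℝ (fun y => fderiv ℝ S y (EuclideanSpace.single 0 1)) x (EuclideanSpace.single 0 1) +
          2 * ((m : ℝ) + 3) * cylRadius x ^ (2 * m + 5) * S x ^ (2 * m + 5) *
          fderiv ℝ (fun y => fderiv ℝ S y (EuclideanSpace.single 1 1)) x (EuclideanSpace.single 1 1) :=
        (iPD2 0).add (iPD2 1)
      rw [← integral_add (iPD2 0) (iPD2 1), ← integral_add i01 (iPD2 2)]
      refine integral_congr_ae (ae_of_all _ fun x => ?_)
      simp only [hlap x]
      ring
    have e0 : ∀ x : EuclideanSpace ℝ (Fin 3), x 0 * (EuclideanSpace.single (0 : Fin 3) (1 : ℝ)) 0 +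
        x 1 * (EuclideanSpace.single (0 : Fin 3) (1 : ℝ)) 1 = x 0 := fun x => by simp
    have e1 : ∀ x : EuclideanSpace ℝ (Fin 3), x 0 * (EuclideanSpace.single (1 : Fin 3) (1 : ℝ)) 0 +
        x 1 * (EuclideanSpace.single (1 : Fin 3) (1 : ℝ)) 1 = x 1 := fun x => by simp
    have e2 : ∀ x : EuclideanSpace ℝ (Fin 3), x 0 * (EuclideanSpace.single (2 : Fin 3) (1 : ℝ)) 0 +
        x 1 * (EuclideanSpace.single (2 : Fin 3) (1 : ℝ)) 1 = 0 := fun x => by simp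
    have hM0 : ∫ x, cylRadius x ^ (2 * m + 3) * (x 0 * (EuclideanSpace.single (0 : Fin 3) (1 : ℝ)) 0 +
        x 1 * (EuclideanSpace.single (0 : Fin 3) (1 : ℝ)) 1) * S x ^ (2 * m + 5) *
        fderiv ℝ S x (EuclideanSpace.single 0 1) =
        ∫ x, cylRadius x ^ (2 * m + 3) * S x ^ (2 * m + 5) * (x 0 * fderiv ℝ S x (EuclideanSpace.single 0 1)) :=
      integral_congr_ae (ae_of_all _ fun x => by simp only [e0 x]; ring)
    have hM1 : ∫ x, cylRadius x ^ (2 * m + 3) * (x 0 * (EuclideanSpace.single (1 : Fin 3) (1 : ℝ)) 0 +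
        x 1 * (EuclideanSpace.single (1 : Fin 3) (1 : ℝ)) 1) * S x ^ (2 * m + 5) *
        fderiv ℝ S x (EuclideanSpace.single 1 1) =
        ∫ x, cylRadius x ^ (2 * m + 3) * S x ^ (2 * m + 5) * (x 1 * fderiv ℝ S x (EuclideanSpace.single 1 1)) :=
      integral_congr_ae (ae_of_all _ fun x => by simp only [e1 x]; ring)
    have hM2 : ∫ x, cylRadius x ^ (2 * m + 3) * (x 0 * (EuclideanSpace.single (2 : Fin 3) (1 : ℝ)) 0 +
        x 1 * (EuclideanSpace.single (2 : Fin 3) (1 : ℝ)) 1) * S x ^ (2 * m + 5) *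
        fderiv ℝ S x (EuclideanSpace.single 2 1) = 0 := by
      refine integral_eq_zero_of_ae (ae_of_all _ fun x => ?_)
      simp only [e2 x, Pi.zero_apply]
      ring
    rw [hsum, hE3i 0, hE3i 1, hE3i 2, hM0, hM1, hM2, hIMsum, hIDsum]
    ring
  ------------------------------------------------------------------
  -- (E4) the drift term: `∫ P q = 2(m+3) I_M` (`r² q = x₀∂₀S + x₁∂₁S`)
  ------------------------------------------------------------------
  have hE4 : ∫ x, 2 * ((m : ℝ) + 3) * cylRadius x ^ (2 * m + 5) * S x ^ (2 * m + 5) * radDerivQuot S x =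
      2 * ((m : ℝ) + 3) * IM := by
    rw [hIM, ← integral_const_mul]
    refine integral_congr_ae (ae_of_all _ fun x => ?_)
    have h := horizontal_inner_fderiv_eq_cylRadius_sq_mul_radDerivQuot hS hax x
    calc 2 * ((m : ℝ) + 3) * cylRadius x ^ (2 * m + 5) * S x ^ (2 * m + 5) * radDerivQuot S x
        = 2 * ((m : ℝ) + 3) * (cylRadius x ^ (2 * m + 3) * S x ^ (2 * m + 5) *
            (cylRadius x ^ 2 * radDerivQuot S x)) := by ring
      _ = 2 * ((m : ℝ) + 3) * (cylRadius x ^ (2 * m + 3) * S x ^ (2 * m + 5) *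
            (x 0 * fderiv ℝ S x (EuclideanSpace.single 0 1) +
              x 1 * fderiv ℝ S x (EuclideanSpace.single 1 1))) := by rw [h]
  ------------------------------------------------------------------
  -- (E5) `2(m+3) I_M = −(2m+5) I_A` (integration by parts against `r^{2m+3} xᵢ`, `i = 0, 1`)
  ------------------------------------------------------------------
  have hE5 : 2 * ((m : ℝ) + 3) * IM = -((2 * m + 5 : ℝ) * IA) := by
    have hJ : ∀ i : Fin 3, ∫ x, cylRadius x ^ (2 * m + 3) * x i *
        fderiv ℝ (fun y => S y ^ (2 * m + 6)) x (EuclideanSpace.single i 1) =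
        (2 * m + 6 : ℝ) * ∫ x, cylRadius x ^ (2 * m + 3) * S x ^ (2 * m + 5) *
          (x i * fderiv ℝ S x (EuclideanSpace.single i 1)) := by
      intro i
      rw [← integral_const_mul]
      refine integral_congr_ae (ae_of_all _ fun x => ?_)
      simp only [fderiv_pow_apply' hSd (2 * m + 6) x (EuclideanSpace.single i 1),
        show 2 * m + 6 - 1 = 2 * m + 5 by omega]
      push_cast; ring
    have h0 := hJ 0
    have h1 := hJ 1
    rw [radial_aux hS hSF hSL m0 0 (Or.inl rfl) (m1 0) m] at h0
    rw [radial_aux hS hSF hSL m0 1 (Or.inr rfl) (m1 1) m] at h1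
    have hsumA : (∫ x, ((2 * m + 3 : ℝ) * cylRadius x ^ (2 * m + 1) * (x 0 * x 0) +
        cylRadius x ^ (2 * m + 3)) * S x ^ (2 * m + 6)) +
        ∫ x, ((2 * m + 3 : ℝ) * cylRadius x ^ (2 * m + 1) * (x 1 * x 1) +
          cylRadius x ^ (2 * m + 3)) * S x ^ (2 * m + 6) = (2 * m + 5 : ℝ) * IA := by
      rw [← integral_add (integrable_radial_aux hSc hSF hSL m0 0 (Or.inl rfl) m)
        (integrable_radial_aux hSc hSF hSL m0 1 (Or.inr rfl) m), hIA, ← integral_const_mul]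
      refine integral_congr_ae (ae_of_all _ fun x => ?_)
      beta_reduce
      have hr2 : x 0 * x 0 + x 1 * x 1 = cylRadius x ^ 2 := by rw [cylRadius_sq]; ring
      linear_combination ((2 * m + 3 : ℝ) * cylRadius x ^ (2 * m + 1) * S x ^ (2 * m + 6)) * hr2
    rw [hIMsum]
    linear_combination (-1 : ℝ) * h0 - h1 - hsumA
  ------------------------------------------------------------------
  -- the dissipation functional `∫ (…) = I_A + 2 I_M + I_D`
  ------------------------------------------------------------------
  have hq : ∀ x, cylRadius x ^ (2 * m + 5) * S x ^ (2 * m + 5) * radDerivQuot S x =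
      cylRadius x ^ (2 * m + 3) * S x ^ (2 * m + 5) *
        (x 0 * fderiv ℝ S x (EuclideanSpace.single 0 1) + x 1 * fderiv ℝ S x (EuclideanSpace.single 1 1)) :=
    fun x => by rw [horizontal_inner_fderiv_eq_cylRadius_sq_mul_radDerivQuot hS hax x]; ring
  have hXD : ∫ x, (cylRadius x ^ (2 * m + 3) * S x ^ (2 * m + 6) +
      2 * cylRadius x ^ (2 * m + 5) * S x ^ (2 * m + 5) * radDerivQuot S x +
      cylRadius x ^ (2 * m + 5) * S x ^ (2 * m + 4) * ‖fderiv ℝ S x‖ ^ 2) = IA + 2 * IM + ID := by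
    have i2 : Integrable fun x => 2 * cylRadius x ^ (2 * m + 5) * S x ^ (2 * m + 5) * radDerivQuot S x := by
      refine (iM.const_mul 2).congr (ae_of_all _ fun x => ?_)
      beta_reduce
      rw [← hq x]; ring
    have i12 : Integrable fun x => cylRadius x ^ (2 * m + 3) * S x ^ (2 * m + 6) +
        2 * cylRadius x ^ (2 * m + 5) * S x ^ (2 * m + 5) * radDerivQuot S x := iAint.add i2
    rw [integral_add i12 iD, integral_add iAint i2, hIA, hIM, hID, ← integral_const_mul]
    congr 2
    exact integral_congr_ae (ae_of_all _ fun x => by beta_reduce; rw [← hq x]; ring)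
  ------------------------------------------------------------------
  -- conclusion: the total is `(2m+5) I_T − ν (2m+5) I_A ≤ (2m+5) I_T`
  ------------------------------------------------------------------
  rw [hXD, hE1, hE2, hE3, hE4]
  have hsl : 0 ≤ ν * ((2 * m + 5 : ℝ) * IA) := mul_nonneg hν (mul_nonneg (by positivity) hIA0)
  have hE5' : ν * (2 * m + 7) * (2 * ((m : ℝ) + 3) * IM) = ν * (2 * m + 7) * -((2 * m + 5 : ℝ) * IA) := by
    rw [hE5]
  nlinarith [hE5', hsl]

end Slice

/-! ### Tao's class: the slice inequality and the balance for `∫ r^{2k−1} η^{2k} = 2π ∫_Ω ω_θ^{2k}` -/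

section TaoClass

variable {T ν : ℝ} {u₀ : EuclideanSpace ℝ (Fin 3) → EuclideanSpace ℝ (Fin 3)}
  {v : ℝ → EuclideanSpace ℝ (Fin 3) → EuclideanSpace ℝ (Fin 3)} {q : ℝ → EuclideanSpace ℝ (Fin 3) → ℝ}
  {k : ℕ}

/-- Without swirl `u^θ/r ≡ 0`: `angVelQuot u = 0` when `swirl u ≡ 0`. [folklore] -/
private theorem angVelQuot_eq_zero_of_hasNoSwirl₃
    {u : EuclideanSpace ℝ (Fin 3) → EuclideanSpace ℝ (Fin 3)} (hsw : HasNoSwirl u) :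
    angVelQuot u = 0 := by
  have h0 : swirl u = fun _ => 0 := funext fun x => hsw x
  funext x
  simp only [angVelQuot, h0, Pi.zero_apply]
  have h1 : radDerivQuot (fun _ : EuclideanSpace ℝ (Fin 3) => (0 : ℝ)) = fun _ => 0 := by
    funext y
    simp [radDerivQuot, hadamardQuotFst]
  simp [radQuot, h1]

/-- **`|ω_θ| = r|η|` is bounded on the slab**: along a Tao-class solution with axisymmetric slices,
`r |angVortQuot (v t) x| ≤ L` for all `t ∈ [0, T]`, `x` (`r|ω_θ/r| ≤ ‖ω‖ ≤ ‖curlCLM‖ ‖Dv‖`, and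
`Dv` is bounded on the slab by the Sobolev bounds) — the standing `ω_θ ∈ C⁰((0,T], L^∞(Ω))` of
Gallay–Šverák's §5, here in Tao's smooth class. [cite: GallaySverak2016, §5, first paragraph (arXiv p. 16)] -/
theorem IsTaoSolutionOn.exists_forall_cylRadius_mul_abs_angVortQuot_le
    (h : IsTaoSolutionOn T ν u₀ v q) (hax : ∀ t ∈ Icc 0 T, IsAxisymmetric (v t)) :
    ∃ L : ℝ, 0 ≤ L ∧ ∀ t ∈ Icc 0 T, ∀ x, cylRadius x * |angVortQuot (v t) x| ≤ L := by
  obtain ⟨B', hB'0, hB'⟩ := h.exists_bound_fderiv_velocity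
  refine ⟨‖(curlCLM : (EuclideanSpace ℝ (Fin 3) →L[ℝ] EuclideanSpace ℝ (Fin 3)) →L[ℝ]
      EuclideanSpace ℝ (Fin 3))‖ * B', by positivity, fun t ht x => ?_⟩
  have hv3 : ContDiff ℝ 3 (v t) := (h.classical.contDiff_velocity ht).of_le (by norm_cast)
  exact ((hax t ht).cylRadius_mul_abs_angVortQuot_le hv3 x).trans
    ((norm_curl_le_norm_curlCLM_mul (v t) x).trans
      (mul_le_mul_of_nonneg_left (hB' t ht x) (norm_nonneg curlCLM)))

/-- **`L²` data of `ω_θ = rη` at a fixed time** in Tao's class with axisymmetric slices: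
`rη ∈ L²` (`|rη| ≤ ‖ω‖`) and `r∂ᵢη ∈ L²` (`r|∂ᵢη| ≤ |∂ᵢη| + 3‖ω‖ + ‖Dω‖`,
`IsAxisymmetric.cylRadius_mul_abs_fderiv_angVortQuot_le`), with `ω, Dω ∈ L²` from the Sobolev
bounds of the class — the `ω_θ, ∇ω_θ ∈ L²(Ω)` used in Gallay–Šverák's energy identity (5.8), in the
tree's `ℝ³` variables (`∫_Ω ω_θ² dr dz = (2π)⁻¹∫ r η² dx`).
[cite: GallaySverak2016, proof of Prop. 5.3, (5.8) (arXiv p. 16)] -/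
theorem IsTaoSolutionOn.memLp_cylRadius_mul_angVortQuot (h : IsTaoSolutionOn T ν u₀ v q)
    (hax : ∀ t ∈ Icc 0 T, IsAxisymmetric (v t)) {t : ℝ} (ht : t ∈ Icc 0 T) :
    MemLp (fun x => cylRadius x * angVortQuot (v t) x) 2 volume ∧
    ∀ i : Fin 3, MemLp (fun x => cylRadius x *
      fderiv ℝ (angVortQuot (v t)) x (EuclideanSpace.single i 1)) 2 volume := by
  have hvs : ContDiff ℝ ∞ (v t) := h.classical.contDiff_velocity ht
  have hv1 : ContDiff ℝ 1 (v t) := hvs.of_le (by norm_cast)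
  have hv2 : ContDiff ℝ 2 (v t) := hvs.of_le (by norm_cast)
  have hv3 : ContDiff ℝ 3 (v t) := hvs.of_le (by norm_cast)
  have hv4 : ContDiff ℝ 4 (v t) := hvs.of_le (by norm_cast)
  have haxt := hax t ht
  have hΩ : ContDiff ℝ ∞ (angVortQuot (v t)) := contDiff_angVortQuot_of_contDiff hvs
  have cΩ := hΩ.continuous
  have cDΩ : ∀ w : EuclideanSpace ℝ (Fin 3), Continuous fun x => fderiv ℝ (angVortQuot (v t)) x w :=
    fun w => (hΩ.continuous_fderiv (by simp)).clm_apply continuous_const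
  have hH : ∀ n : ℕ, ∫⁻ x, ‖iteratedFDeriv ℝ n (v t) x‖ₑ ^ 2 < ⊤ := fun n => by
    obtain ⟨C, hC⟩ := h.sobolev n; exact (hC t ht).trans_lt ENNReal.coe_lt_top
  have mD : ∀ n : ℕ, MemLp (fun x => ‖iteratedFDeriv ℝ n (v t) x‖) 2 volume := fun n =>
    memLp_two_of_norm_le_of_lintegral (hvs.continuous_iteratedFDeriv (by exact_mod_cast le_top)).norm
      (fun x => by rw [norm_norm]) (hH n)
  set w : EuclideanSpace ℝ (Fin 3) → EuclideanSpace ℝ (Fin 3) := FluidPDE.curl (v t) with hw_def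
  have hwC : ContDiff ℝ ∞ w := contDiff_curl (n := (⊤ : ℕ∞)) (by exact_mod_cast hvs)
  set c : ℝ := ‖(curlCLM : (EuclideanSpace ℝ (Fin 3) →L[ℝ] EuclideanSpace ℝ (Fin 3)) →L[ℝ]
      EuclideanSpace ℝ (Fin 3))‖ with hc_def
  have hc0 : 0 ≤ c := by positivity
  have mw0 : MemLp (fun x => ‖w x‖) 2 volume := by
    refine memLp_of_norm_le_const_mul hwC.continuous.norm hc0 (fun x => ?_) (mD 1)
    rw [norm_norm]
    have := norm_iteratedFDeriv_curl_le (n := 0) (by exact_mod_cast hv1) x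
    rwa [norm_iteratedFDeriv_zero] at this
  have mw1 : MemLp (fun x => ‖fderiv ℝ w x‖) 2 volume := by
    refine memLp_of_norm_le_const_mul (hwC.continuous_fderiv (by simp)).norm hc0 (fun x => ?_) (mD 2)
    rw [norm_norm]
    have := norm_iteratedFDeriv_curl_le (n := 1) (by exact_mod_cast hv2) x
    rwa [← norm_iteratedFDeriv_fderiv (n := 0), norm_iteratedFDeriv_zero] at this
  obtain ⟨-, m1, -, -⟩ := h.memLp_angVortQuot_data hax ht
  refine ⟨?_, fun i => ?_⟩
  · refine memLp_of_norm_le_const_mul (continuous_cylRadius.mul cΩ) zero_le_one (fun x => ?_) mw0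
    rw [one_mul, Real.norm_eq_abs, abs_mul, abs_of_nonneg (cylRadius_nonneg x)]
    exact haxt.cylRadius_mul_abs_angVortQuot_le hv3 x
  · have hM : MemLp (fun x => ‖fderiv ℝ (angVortQuot (v t)) x (EuclideanSpace.single i 1)‖ +
        3 * ‖w x‖ + ‖fderiv ℝ w x‖) 2 volume := ((m1 i).norm.add (mw0.const_mul 3)).add mw1
    refine hM.of_le ((continuous_cylRadius.mul (cDΩ _)).aestronglyMeasurable)
      (ae_of_all _ fun x => ?_)
    have hb := haxt.cylRadius_mul_abs_fderiv_angVortQuot_le hv4 (norm_euclideanSpace_single_one_le i) x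
    have hnn : 0 ≤ ‖fderiv ℝ (angVortQuot (v t)) x (EuclideanSpace.single i 1)‖ + 3 * ‖w x‖ +
        ‖fderiv ℝ w x‖ := by positivity
    rw [Real.norm_eq_abs, abs_mul, abs_of_nonneg (cylRadius_nonneg x), Real.norm_of_nonneg hnn,
      Real.norm_eq_abs]
    exact hb

/-- **The slice inequality for `∫_Ω ω_θ^{2k}` with dissipation in Tao's class.** For a Tao-class
solution on `[0, T]` (`ν ≥ 0`) whose slices are axisymmetric without swirl, `k ≥ 3`,
`t ∈ [0, T]`, and any upper bound `u_r/r = radVelQuot (v t) ≤ W`, with `η = angVortQuot (v t)`,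
`η' = angVortQuot (∂ₜv t)`:
`∫ 2k r^{2k−1} η^{2k−1} η' + ν·2(2k−1)k ∫ (r^{2k−3}η^{2k} + 2r^{2k−1}η^{2k−1}(∂ᵣη)/r
+ r^{2k−1}η^{2k−2}‖Dη‖²) ≤ (2k−1) W ∫ r^{2k−1} η^{2k}` — Gallay–Šverák's (5.8) for the exponent
`p = 2k` with `∫_Ω (u_r/r) ω_θ^p ≤ ‖u_r/r‖ ∫_Ω ω_θ^p` (their (5.9) step uses
`‖u_r/r‖_{L^∞} ≤ C‖ω_θ/r‖_{L¹}^{1/3}‖ω_θ/r‖_{L^∞}^{2/3}`, the tree's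
`IsTaoSolutionOn.abs_radVelQuot_le_nash_of_datum`).
[cite: GallaySverak2016, proof of Prop. 5.3, (5.8)–(5.9) (arXiv p. 16–17)] -/
theorem IsTaoSolutionOn.integral_weight_pow_mul_angVortQuot_deriv_add_dissipation_le
    (h : IsTaoSolutionOn T ν u₀ v q) (hT : 0 < T) (hν : 0 ≤ ν)
    (hax : ∀ t ∈ Icc 0 T, IsAxisymmetric (v t)) (hsw : ∀ t ∈ Icc 0 T, HasNoSwirl (v t))
    (hk : 3 ≤ k) {t : ℝ} (ht : t ∈ Icc 0 T) {W : ℝ} (hW : ∀ x, radVelQuot (v t) x ≤ W) :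
    (∫ x, 2 * k * cylRadius x ^ (2 * k - 1) * angVortQuot (v t) x ^ (2 * k - 1) *
        angVortQuot (timeDerivWithin (Icc 0 T) v t) x) +
      ν * (2 * (2 * k - 1) * k) * ∫ x, (cylRadius x ^ (2 * k - 3) * angVortQuot (v t) x ^ (2 * k) +
        2 * cylRadius x ^ (2 * k - 1) * angVortQuot (v t) x ^ (2 * k - 1) *
          radDerivQuot (angVortQuot (v t)) x +
        cylRadius x ^ (2 * k - 1) * angVortQuot (v t) x ^ (2 * k - 2) *
          ‖fderiv ℝ (angVortQuot (v t)) x‖ ^ 2) ≤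
      (2 * k - 1) * W * ∫ x, cylRadius x ^ (2 * k - 1) * angVortQuot (v t) x ^ (2 * k) := by
  have hU : UniqueDiffOn ℝ (Icc 0 T) := uniqueDiffOn_Icc hT
  have hcl := Icc_subset_closure_interior_Icc' hT
  obtain ⟨F, -, hF⟩ := h.exists_forall_abs_angVortQuot_le hax
  obtain ⟨L, -, hL⟩ := h.exists_forall_cylRadius_mul_abs_angVortQuot_le hax
  have hvs : ContDiff ℝ ∞ (v t) := h.classical.contDiff_velocity ht
  have hv1 : ContDiff ℝ 1 (v t) := hvs.of_le (by norm_cast)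
  have hv2 : ContDiff ℝ 2 (v t) := hvs.of_le (by norm_cast)
  have hv3 : ContDiff ℝ 3 (v t) := hvs.of_le (by norm_cast)
  have hΩ2 : ContDiff ℝ 2 (angVortQuot (v t)) :=
    contDiff_angVortQuot (n := 2) (by exact_mod_cast hvs.of_le (by norm_cast))
  have hΩc : Continuous (angVortQuot (v t)) := hΩ2.continuous
  have hΩax : IsAxisymmetricScalar (angVortQuot (v t)) :=
    (hax t ht).isAxisymmetricScalar_angVortQuot hv3
  obtain ⟨m0, m1, m2, mq⟩ := h.memLp_angVortQuot_data hax ht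
  obtain ⟨mG, mGD⟩ := h.memLp_cylRadius_mul_angVortQuot hax ht
  obtain ⟨B, -, hB⟩ := exists_bound_velocity h
  obtain ⟨B', -, hB'⟩ := h.exists_bound_fderiv_velocity
  have hΦ0 : angVelQuot (v t) = 0 := angVelQuot_eq_zero_of_hasNoSwirl₃ (hsw t ht)
  have heq : ∀ x, angVortQuot (timeDerivWithin (Icc 0 T) v t) x +
      fderiv ℝ (angVortQuot (v t)) x (v t x) =
      ν * ((Δ (angVortQuot (v t))) x + 2 * radDerivQuot (angVortQuot (v t)) x) := fun x => by
    rw [h.classical.angVortQuot_eq hU hcl hax ht x, hΦ0]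
    simp
  have hmain := integral_weight_pow_mul_deriv_add_dissipation_le_of_drift_laplacian hk hΩ2 hΩax
    (hF t ht) (hL t ht) m0 m1 m2 mq mG mGD hv1 (h.classical.divFree t ht) (hB t ht) (hB' t ht) hν heq
  refine hmain.trans ?_
  -- `∫ r^{2k−3}(x₀u₀ + x₁u₁) η^{2k} ≤ W ∫ r^{2k−1} η^{2k}` (`x₀u₀ + x₁u₁ = r² · radVelQuot u`)
  obtain ⟨m, rfl⟩ : ∃ m, k = m + 3 := ⟨k - 3, by omega⟩
  have n1 : 2 * (m + 3) - 1 = 2 * m + 5 := by omega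
  have n3 : 2 * (m + 3) - 3 = 2 * m + 3 := by omega
  have n0 : 2 * (m + 3) = 2 * m + 6 := by omega
  simp only [n1, n3]
  simp only [n0]
  push_cast
  have hk1 : (0 : ℝ) ≤ 2 * ((m : ℝ) + 3) - 1 := by
    have : (0 : ℝ) ≤ m := Nat.cast_nonneg m
    linarith
  have hpt : ∀ x, cylRadius x ^ (2 * m + 3) * (x 0 * v t x 0 + x 1 * v t x 1) *
      angVortQuot (v t) x ^ (2 * m + 6) =
      radVelQuot (v t) x * (cylRadius x ^ (2 * m + 5) * angVortQuot (v t) x ^ (2 * m + 6)) := by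
    intro x
    rw [← (hax t ht).cylRadius_sq_mul_radVelQuot hv2 x]; ring
  have hnn : ∀ x, 0 ≤ cylRadius x ^ (2 * m + 5) * angVortQuot (v t) x ^ (2 * m + 6) := fun x => by
    have : angVortQuot (v t) x ^ (2 * m + 6) = (angVortQuot (v t) x ^ (m + 3)) ^ 2 := by ring
    rw [this]
    exact mul_nonneg (pow_nonneg (cylRadius_nonneg x) _) (sq_nonneg _)
  have iGS : Integrable fun x => cylRadius x * angVortQuot (v t) x * angVortQuot (v t) x :=
    mG.integrable_mul m0
  have iA : Integrable fun x => cylRadius x ^ (2 * m + 5) * angVortQuot (v t) x ^ (2 * m + 6) := by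
    refine (integrable_pat1 hΩc (hL t ht) iGS 1 (2 * m + 4)).congr (ae_of_all _ fun x => ?_)
    simp only; ring
  have hqc : Continuous (radVelQuot (v t)) :=
    (contDiff_radVelQuot (n := 0) (by exact_mod_cast hv2)).continuous
  have hqB : ∀ x, |radVelQuot (v t) x| ≤ B' := fun x =>
    ((hax t ht).abs_radVelQuot_le_norm_fderiv hv2 x).trans (hB' t ht x)
  have iB : Integrable fun x => radVelQuot (v t) x *
      (cylRadius x ^ (2 * m + 5) * angVortQuot (v t) x ^ (2 * m + 6)) :=
    integrable_bdd_mul' B' hqc hqB iA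
  have hI : ∫ x, cylRadius x ^ (2 * m + 3) * (x 0 * v t x 0 + x 1 * v t x 1) *
      angVortQuot (v t) x ^ (2 * m + 6) ≤
      W * ∫ x, cylRadius x ^ (2 * m + 5) * angVortQuot (v t) x ^ (2 * m + 6) := by
    rw [integral_congr_ae (ae_of_all _ hpt), ← integral_const_mul]
    exact integral_mono iB (iA.const_mul W) fun x => mul_le_mul_of_nonneg_right (hW x) (hnn x)
  calc (2 * ((m : ℝ) + 3) - 1) * ∫ x, cylRadius x ^ (2 * m + 3) * (x 0 * v t x 0 + x 1 * v t x 1) *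
        angVortQuot (v t) x ^ (2 * m + 6)
      ≤ (2 * ((m : ℝ) + 3) - 1) * (W * ∫ x, cylRadius x ^ (2 * m + 5) *
          angVortQuot (v t) x ^ (2 * m + 6)) := mul_le_mul_of_nonneg_left hI hk1
    _ = (2 * ((m : ℝ) + 3) - 1) * W * ∫ x, cylRadius x ^ (2 * m + 5) *
          angVortQuot (v t) x ^ (2 * m + 6) := by ring

/-- **The balance for `F_k(τ) = ∫ r^{2k−1} η(τ)^{2k} dx = 2π ∫_Ω ω_θ^{2k} dr dz` in Tao's class**
(`k ≥ 3`, axisymmetric slices): the rate `σ_k(τ) = ∫ 2k r^{2k−1} η^{2k−1} η' dx`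
(`η' = angVortQuot (∂ₜv τ)`) is integrable on `(0, T)`, `F_k` is continuous on `[0, T]`, and
`F_k(t) − F_k(s) = ∫ₛᵗ σ_k` for `0 ≤ s ≤ t ≤ T` (differentiation under the integral along the
jointly smooth family `η`, with the uniform majorant `|2k r^{2k−1}η^{2k−1}η'| ≤ 2k L^{2k−2}
(‖ω‖² + η'²)`, `ω, η' ∈ L^∞_t L²_x`) — the time-integrated form in which Gallay–Šverák's `(5.8)`
and Feng–Šverák's `dE_p/dt` computations are used.
[cite: GallaySverak2016, proof of Prop. 5.3 (arXiv p. 16–17); FengSverak2015, proof of Lemma 3.8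
(arXiv p. 12)] -/
theorem IsTaoSolutionOn.integral_weight_pow_angVortQuot_balance (h : IsTaoSolutionOn T ν u₀ v q)
    (hT : 0 < T) (hax : ∀ t ∈ Icc 0 T, IsAxisymmetric (v t)) (hk : 3 ≤ k) :
    IntegrableOn (fun τ => ∫ x, 2 * k * cylRadius x ^ (2 * k - 1) * angVortQuot (v τ) x ^ (2 * k - 1) *
        angVortQuot (timeDerivWithin (Icc 0 T) v τ) x) (Ioo 0 T) ∧
    ContinuousOn (fun τ => ∫ x, cylRadius x ^ (2 * k - 1) * angVortQuot (v τ) x ^ (2 * k)) (Icc 0 T) ∧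
    ∀ s t, 0 ≤ s → s ≤ t → t ≤ T →
      (∫ x, cylRadius x ^ (2 * k - 1) * angVortQuot (v t) x ^ (2 * k)) -
        (∫ x, cylRadius x ^ (2 * k - 1) * angVortQuot (v s) x ^ (2 * k)) =
      ∫ τ in s..t, ∫ x, 2 * k * cylRadius x ^ (2 * k - 1) * angVortQuot (v τ) x ^ (2 * k - 1) *
        angVortQuot (timeDerivWithin (Icc 0 T) v τ) x := by
  obtain ⟨m, rfl⟩ : ∃ m, k = m + 3 := ⟨k - 3, by omega⟩
  have n1 : 2 * (m + 3) - 1 = 2 * m + 5 := by omega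
  have n0 : 2 * (m + 3) = 2 * m + 6 := by omega
  simp only [n1]
  simp only [n0]
  push_cast
  have hU : UniqueDiffOn ℝ (Icc 0 T) := uniqueDiffOn_Icc hT
  have hcl := Icc_subset_closure_interior_Icc' hT
  have hsm : IsSmoothSpaceTimeOn (Icc 0 T) v := h.classical.smooth_velocity
  have hvs : ∀ t ∈ Icc 0 T, ContDiff ℝ ∞ (v t) := fun t ht => h.classical.contDiff_velocity ht
  have hΩc : ∀ t ∈ Icc 0 T, Continuous (angVortQuot (v t)) := fun t ht =>
    (contDiff_angVortQuot (n := 0) (by exact_mod_cast (hvs t ht).of_le (by norm_cast))).continuous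
  obtain ⟨L, hL0, hL⟩ := h.exists_forall_cylRadius_mul_abs_angVortQuot_le hax
  -- the jointly smooth family `η` and its time derivative
  have hΩ : IsSmoothSpaceTimeOn (Icc 0 T) (fun t => angVortQuot (v t)) :=
    hsm.angVortQuot_family (convex_Icc 0 T) hU
  have hΩ' : IsSmoothSpaceTimeOn (Icc 0 T) (timeDerivWithin (Icc 0 T) fun t => angVortQuot (v t)) :=
    hΩ.timeDerivWithin hU
  have hdt : ∀ t ∈ Icc 0 T, ∀ x, timeDerivWithin (Icc 0 T) (fun s => angVortQuot (v s)) t x =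
      angVortQuot (timeDerivWithin (Icc 0 T) v t) x := fun t ht x =>
    hsm.timeDerivWithin_angVortQuot (convex_Icc 0 T) hU hcl hax ht x
  have tl : ∀ {w : ℝ → EuclideanSpace ℝ (Fin 3) → ℝ},
      ContinuousOn (uncurry w) (Icc 0 T ×ˢ univ) → ∀ x, ContinuousOn (fun s => w s x) (Icc 0 T) := by
    intro w hw x
    exact hw.comp (continuous_id.prodMk continuous_const).continuousOn
      fun s hs => mk_mem_prod hs (mem_univ x)
  -- uniform `L²` bounds of `η'` and of `ω`
  obtain ⟨C, hC⟩ := h.exists_lintegral_sq_quot_le hT hax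
  obtain ⟨C₁, hC₁⟩ := h.sobolev 1
  set c : ℝ := ‖(curlCLM : (EuclideanSpace ℝ (Fin 3) →L[ℝ] EuclideanSpace ℝ (Fin 3)) →L[ℝ]
      EuclideanSpace ℝ (Fin 3))‖ with hc_def
  have hω : ∀ t ∈ Icc 0 T, ∀ x, ‖curl (v t) x‖ ≤ c * ‖iteratedFDeriv ℝ 1 (v t) x‖ := fun t ht x => by
    have := norm_iteratedFDeriv_curl_le (n := 0) (by exact_mod_cast (hvs t ht).of_le (by norm_cast)) x
    rwa [norm_iteratedFDeriv_zero] at this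
  ------------------------------------------------------------------
  -- (i) time lines
  ------------------------------------------------------------------
  have hline : ∀ᵐ x ∂(volume : Measure (EuclideanSpace ℝ (Fin 3))),
      ContinuousOn (fun t => cylRadius x ^ (2 * m + 5) * angVortQuot (v t) x ^ (2 * m + 6)) (Icc 0 T) ∧
      ContinuousOn (fun t => 2 * ((m : ℝ) + 3) * cylRadius x ^ (2 * m + 5) *
        angVortQuot (v t) x ^ (2 * m + 5) * angVortQuot (timeDerivWithin (Icc 0 T) v t) x) (Icc 0 T) ∧
      ∀ t ∈ Ioo 0 T, HasDerivAt (fun t => cylRadius x ^ (2 * m + 5) * angVortQuot (v t) x ^ (2 * m + 6))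
        (2 * ((m : ℝ) + 3) * cylRadius x ^ (2 * m + 5) * angVortQuot (v t) x ^ (2 * m + 5) *
          angVortQuot (timeDerivWithin (Icc 0 T) v t) x) t := by
    refine ae_of_all _ fun x => ⟨continuousOn_const.mul ((tl hΩ.continuousOn x).pow _),
      ((continuousOn_const.mul ((tl hΩ.continuousOn x).pow _)).mul
        ((tl hΩ'.continuousOn x).congr fun s hs => (hdt s hs x).symm)), fun t ht => ?_⟩
    have htI : t ∈ Icc 0 T := Ioo_subset_Icc_self ht
    have h1 : HasDerivWithinAt (fun s => angVortQuot (v s) x)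
        (timeDerivWithin (Icc 0 T) (fun s => angVortQuot (v s)) t x) (Icc 0 T) t := by
      rw [timeDerivWithin_apply]
      exact (hΩ.differentiableWithinAt_time htI x).hasDerivWithinAt
    rw [hdt t htI x] at h1
    have h2 : HasDerivAt (fun s => angVortQuot (v s) x)
        (angVortQuot (timeDerivWithin (Icc 0 T) v t) x) t := h1.hasDerivAt (Icc_mem_nhds ht.1 ht.2)
    refine ((h2.pow (2 * m + 6)).const_mul (cylRadius x ^ (2 * m + 5))).congr_deriv ?_
    rw [show 2 * m + 6 - 1 = 2 * m + 5 by omega]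
    push_cast
    ring
  ------------------------------------------------------------------
  -- (ii) joint measurability of the rate integrand
  ------------------------------------------------------------------
  have hmeas0 : AEStronglyMeasurable (uncurry fun t x => 2 * ((m : ℝ) + 3) * cylRadius x ^ (2 * m + 5) *
      angVortQuot (v t) x ^ (2 * m + 5) * angVortQuot (timeDerivWithin (Icc 0 T) v t) x)
      ((volume.restrict (Ioo 0 T)).prod volume) := by
    refine aestronglyMeasurable_prod_of_continuousOn_off_axis ?_
    have hsub : Ioo 0 T ×ˢ {x : EuclideanSpace ℝ (Fin 3) | cylRadius x ≠ 0} ⊆ Icc 0 T ×ˢ univ :=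
      prod_mono Ioo_subset_Icc_self (subset_univ _)
    have cr : ContinuousOn (fun p : ℝ × EuclideanSpace ℝ (Fin 3) => cylRadius p.2) (Icc 0 T ×ˢ univ) :=
      (continuous_cylRadius.comp continuous_snd).continuousOn
    have c1 : ContinuousOn (uncurry fun t x => angVortQuot (v t) x) (Icc 0 T ×ˢ univ) := hΩ.continuousOn
    have c2 : ContinuousOn (uncurry (timeDerivWithin (Icc 0 T) fun t => angVortQuot (v t)))
        (Icc 0 T ×ˢ univ) := hΩ'.continuousOn
    have cprod : ContinuousOn (fun p : ℝ × EuclideanSpace ℝ (Fin 3) => 2 * ((m : ℝ) + 3) *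
        cylRadius p.2 ^ (2 * m + 5) * (uncurry (fun t x => angVortQuot (v t) x) p) ^ (2 * m + 5) *
        uncurry (timeDerivWithin (Icc 0 T) fun t => angVortQuot (v t)) p) (Icc 0 T ×ˢ univ) :=
      ((continuousOn_const.mul (cr.pow _)).mul (c1.pow _)).mul c2
    refine (cprod.mono hsub).congr fun p hp => ?_
    obtain ⟨t, x⟩ := p
    have htI : t ∈ Icc 0 T := Ioo_subset_Icc_self hp.1
    simp only [uncurry_apply_pair]
    rw [hdt t htI x]
  have hmeas : AEStronglyMeasurable (uncurry fun t x => deriv (fun y : ℝ => y)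
      (cylRadius x ^ (2 * m + 5) * angVortQuot (v t) x ^ (2 * m + 6)) *
      (2 * ((m : ℝ) + 3) * cylRadius x ^ (2 * m + 5) * angVortQuot (v t) x ^ (2 * m + 5) *
        angVortQuot (timeDerivWithin (Icc 0 T) v t) x))
      ((volume.restrict (Ioo 0 T)).prod volume) := by
    simp only [deriv_id'', one_mul]
    exact hmeas0
  ------------------------------------------------------------------
  -- (iii) the uniform `L¹` bound of the rate integrand
  ------------------------------------------------------------------
  set K : ℝ≥0∞ := ENNReal.ofReal (2 * ((m : ℝ) + 3) * L ^ (2 * m + 4)) *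
    (ENNReal.ofReal (c ^ 2) * C₁ + C) with hK
  have hKtop : K ≠ ⊤ :=
    ENNReal.mul_ne_top ENNReal.ofReal_ne_top (ENNReal.add_ne_top.2
      ⟨ENNReal.mul_ne_top ENNReal.ofReal_ne_top ENNReal.coe_ne_top, ENNReal.coe_ne_top⟩)
  have hbound0 : ∀ t ∈ Ioo 0 T, ∫⁻ x, ‖2 * ((m : ℝ) + 3) * cylRadius x ^ (2 * m + 5) *
      angVortQuot (v t) x ^ (2 * m + 5) * angVortQuot (timeDerivWithin (Icc 0 T) v t) x‖ₑ ≤ K := by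
    intro t ht
    have htI : t ∈ Icc 0 T := Ioo_subset_Icc_self ht
    obtain ⟨-, hη'C, -, -⟩ := hC t htI
    have hv3 : ContDiff ℝ 3 (v t) := (hvs t htI).of_le (by norm_cast)
    have hωc : Continuous (curl (v t)) :=
      (contDiff_curl (n := (⊤ : ℕ∞)) (by exact_mod_cast hvs t htI)).continuous
    have hmω : Measurable fun x => ‖curl (v t) x‖ₑ ^ 2 := hωc.measurable.enorm.pow_const 2
    calc ∫⁻ x, ‖2 * ((m : ℝ) + 3) * cylRadius x ^ (2 * m + 5) * angVortQuot (v t) x ^ (2 * m + 5) *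
          angVortQuot (timeDerivWithin (Icc 0 T) v t) x‖ₑ
        ≤ ∫⁻ x, ENNReal.ofReal (2 * ((m : ℝ) + 3) * L ^ (2 * m + 4)) *
            (‖curl (v t) x‖ₑ ^ 2 + ‖angVortQuot (timeDerivWithin (Icc 0 T) v t) x‖ₑ ^ 2) := by
          refine lintegral_mono fun x => ?_
          have hP1 : cylRadius x * |angVortQuot (v t) x| ≤ ‖curl (v t) x‖ :=
            (hax t htI).cylRadius_mul_abs_angVortQuot_le hv3 x
          have ha0 : 0 ≤ cylRadius x * |angVortQuot (v t) x| :=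
            mul_nonneg (cylRadius_nonneg x) (abs_nonneg _)
          have he0 : 0 ≤ |angVortQuot (timeDerivWithin (Icc 0 T) v t) x| := abs_nonneg _
          have hpw : (cylRadius x * |angVortQuot (v t) x|) ^ (2 * m + 4) ≤ L ^ (2 * m + 4) :=
            pow_le_pow_left₀ ha0 (hL t htI x) _
          have hprod : cylRadius x * |angVortQuot (v t) x| * |angVortQuot (timeDerivWithin (Icc 0 T) v t) x| ≤
              ‖curl (v t) x‖ ^ 2 + angVortQuot (timeDerivWithin (Icc 0 T) v t) x ^ 2 := by
            rw [← sq_abs (angVortQuot (timeDerivWithin (Icc 0 T) v t) x)]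
            nlinarith [mul_le_mul_of_nonneg_right hP1 he0,
              sq_nonneg (‖curl (v t) x‖ - |angVortQuot (timeDerivWithin (Icc 0 T) v t) x|)]
          have hreal : |2 * ((m : ℝ) + 3) * cylRadius x ^ (2 * m + 5) * angVortQuot (v t) x ^ (2 * m + 5) *
              angVortQuot (timeDerivWithin (Icc 0 T) v t) x| ≤
              2 * ((m : ℝ) + 3) * L ^ (2 * m + 4) *
                (‖curl (v t) x‖ ^ 2 + angVortQuot (timeDerivWithin (Icc 0 T) v t) x ^ 2) := by
            have hfac : |2 * ((m : ℝ) + 3) * cylRadius x ^ (2 * m + 5) * angVortQuot (v t) x ^ (2 * m + 5) *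
                angVortQuot (timeDerivWithin (Icc 0 T) v t) x| =
                2 * ((m : ℝ) + 3) * ((cylRadius x * |angVortQuot (v t) x|) ^ (2 * m + 4) *
                  (cylRadius x * |angVortQuot (v t) x| *
                    |angVortQuot (timeDerivWithin (Icc 0 T) v t) x|)) := by
              rw [abs_mul, abs_mul, abs_mul, abs_mul, abs_pow, abs_pow,
                abs_of_nonneg (cylRadius_nonneg x), abs_two,
                abs_of_nonneg (by positivity : (0 : ℝ) ≤ (m : ℝ) + 3)]
              ring
            rw [hfac, mul_assoc (2 * ((m : ℝ) + 3)) (L ^ (2 * m + 4))]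
            refine mul_le_mul_of_nonneg_left ?_ (by positivity)
            exact mul_le_mul hpw hprod (mul_nonneg ha0 he0) (by positivity)
          rw [Real.enorm_eq_ofReal_abs]
          refine (ENNReal.ofReal_le_ofReal hreal).trans (le_of_eq ?_)
          rw [ENNReal.ofReal_mul (by positivity), ENNReal.ofReal_add (sq_nonneg _) (sq_nonneg _),
            ENNReal.ofReal_pow (norm_nonneg _), ofReal_norm,
            Real.enorm_eq_ofReal_abs (angVortQuot (timeDerivWithin (Icc 0 T) v t) x),
            ← ENNReal.ofReal_pow (abs_nonneg _), sq_abs]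
      _ = ENNReal.ofReal (2 * ((m : ℝ) + 3) * L ^ (2 * m + 4)) *
            ((∫⁻ x, ‖curl (v t) x‖ₑ ^ 2) + ∫⁻ x, ‖angVortQuot (timeDerivWithin (Icc 0 T) v t) x‖ₑ ^ 2) := by
          rw [lintegral_const_mul' _ _ ENNReal.ofReal_ne_top, lintegral_add_left hmω]
      _ ≤ K := by
          rw [hK]
          refine mul_le_mul_right (add_le_add ?_ hη'C) _
          calc ∫⁻ x, ‖curl (v t) x‖ₑ ^ 2
              ≤ ∫⁻ x, ENNReal.ofReal (c ^ 2) * ‖iteratedFDeriv ℝ 1 (v t) x‖ₑ ^ 2 := by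
                refine lintegral_mono fun x => ?_
                have h1 := hω t htI x
                have h2 : ‖curl (v t) x‖ ^ 2 ≤ c ^ 2 * ‖iteratedFDeriv ℝ 1 (v t) x‖ ^ 2 := by
                  rw [← mul_pow]
                  exact pow_le_pow_left₀ (norm_nonneg _) h1 2
                rw [← ofReal_norm, ← ofReal_norm, ← ENNReal.ofReal_pow (norm_nonneg _),
                  ← ENNReal.ofReal_pow (norm_nonneg _), ← ENNReal.ofReal_mul (sq_nonneg _)]
                exact ENNReal.ofReal_le_ofReal h2
            _ = ENNReal.ofReal (c ^ 2) * ∫⁻ x, ‖iteratedFDeriv ℝ 1 (v t) x‖ₑ ^ 2 :=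
                lintegral_const_mul' _ _ ENNReal.ofReal_ne_top
            _ ≤ ENNReal.ofReal (c ^ 2) * C₁ := mul_le_mul_right (hC₁ t htI) _
  have hbound : ∀ t ∈ Ioo 0 T, ∫⁻ x, ‖deriv (fun y : ℝ => y)
      (cylRadius x ^ (2 * m + 5) * angVortQuot (v t) x ^ (2 * m + 6)) *
      (2 * ((m : ℝ) + 3) * cylRadius x ^ (2 * m + 5) * angVortQuot (v t) x ^ (2 * m + 5) *
        angVortQuot (timeDerivWithin (Icc 0 T) v t) x)‖ₑ ≤ K := by
    simp only [deriv_id'', one_mul]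
    exact hbound0
  ------------------------------------------------------------------
  -- (iv) the slices `r^{2k−1} η^{2k}` are integrable
  ------------------------------------------------------------------
  have hint : ∀ t ∈ Icc 0 T, Integrable (fun x => (fun y : ℝ => y)
      (cylRadius x ^ (2 * m + 5) * angVortQuot (v t) x ^ (2 * m + 6))) := by
    intro t ht
    obtain ⟨m0, -, -, -⟩ := h.memLp_angVortQuot_data hax ht
    obtain ⟨mG, -⟩ := h.memLp_cylRadius_mul_angVortQuot hax ht
    have iGS : Integrable fun x => cylRadius x * angVortQuot (v t) x * angVortQuot (v t) x :=
      mG.integrable_mul m0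
    refine (integrable_pat1 (hΩc t ht) (hL t ht) iGS 1 (2 * m + 4)).congr (ae_of_all _ fun x => ?_)
    simp only; ring
  ------------------------------------------------------------------
  -- (v) the rate is integrable on `(0, T)` (Fubini with the uniform bound)
  ------------------------------------------------------------------
  have hσ : IntegrableOn (fun τ => ∫ x, 2 * ((m : ℝ) + 3) * cylRadius x ^ (2 * m + 5) *
      angVortQuot (v τ) x ^ (2 * m + 5) * angVortQuot (timeDerivWithin (Icc 0 T) v τ) x) (Ioo 0 T) := by
    set Φ : ℝ × EuclideanSpace ℝ (Fin 3) → ℝ := uncurry fun t x => 2 * ((m : ℝ) + 3) *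
      cylRadius x ^ (2 * m + 5) * angVortQuot (v t) x ^ (2 * m + 5) *
      angVortQuot (timeDerivWithin (Icc 0 T) v t) x with hΦ
    have hI : Integrable Φ ((volume.restrict (Ioo 0 T)).prod volume) := by
      refine ⟨hmeas0, ?_⟩
      have hle := lintegral_prod_le (μ := volume.restrict (Ioo 0 T)) (ν := volume)
        (fun z : ℝ × EuclideanSpace ℝ (Fin 3) => ‖Φ z‖ₑ)
      refine lt_of_le_of_lt hle ?_
      calc ∫⁻ τ in Ioo 0 T, ∫⁻ x, ‖Φ (τ, x)‖ₑ
          ≤ ∫⁻ _ in Ioo 0 T, K := setLIntegral_mono' measurableSet_Ioo fun τ hτ => by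
            simpa only [hΦ, uncurry_apply_pair] using hbound0 τ hτ
        _ < ⊤ := by
            rw [setLIntegral_const]
            exact ENNReal.mul_lt_top hKtop.lt_top (by simp)
    have := hI.integral_prod_left
    simp only [hΦ, uncurry_apply_pair] at this
    exact this
  have hσ' : IntegrableOn (fun τ => ∫ x, 2 * ((m : ℝ) + 3) * cylRadius x ^ (2 * m + 5) *
      angVortQuot (v τ) x ^ (2 * m + 5) * angVortQuot (timeDerivWithin (Icc 0 T) v τ) x) (Icc 0 T) :=
    (integrableOn_Icc_iff_integrableOn_Ioo (μ := volume)).2 hσ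
  have hσi : ∀ a b, a ∈ Icc 0 T → b ∈ Icc 0 T → IntervalIntegrable (fun τ => ∫ x, 2 * ((m : ℝ) + 3) *
      cylRadius x ^ (2 * m + 5) * angVortQuot (v τ) x ^ (2 * m + 5) *
      angVortQuot (timeDerivWithin (Icc 0 T) v τ) x) volume a b := fun a b ha hb =>
    (hσ'.mono_set (uIcc_subset_Icc ha hb)).intervalIntegrable
  ------------------------------------------------------------------
  -- (vi) the balance from `0`: `F(b) = F(0) + ∫₀ᵇ σ`
  ------------------------------------------------------------------
  have hF : ∀ b ∈ Icc 0 T, (∫ x, cylRadius x ^ (2 * m + 5) * angVortQuot (v b) x ^ (2 * m + 6)) =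
      (∫ x, cylRadius x ^ (2 * m + 5) * angVortQuot (v 0) x ^ (2 * m + 6)) +
      ∫ τ in 0..b, ∫ x, 2 * ((m : ℝ) + 3) * cylRadius x ^ (2 * m + 5) *
        angVortQuot (v τ) x ^ (2 * m + 5) * angVortQuot (timeDerivWithin (Icc 0 T) v τ) x := by
    intro b hb
    rcases eq_or_lt_of_le hb.1 with hb0 | hb0
    · rw [← hb0, intervalIntegral.integral_same, add_zero]
    · have key := integral_comp_eq_add_of_ae_hasDerivAt (μ := volume) (T := T) (Φ := fun y : ℝ => y)
        (g := fun t x => cylRadius x ^ (2 * m + 5) * angVortQuot (v t) x ^ (2 * m + 6))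
        (g' := fun t x => 2 * ((m : ℝ) + 3) * cylRadius x ^ (2 * m + 5) * angVortQuot (v t) x ^ (2 * m + 5) *
          angVortQuot (timeDerivWithin (Icc 0 T) v t) x)
        contDiff_id hline hmeas hKtop hbound hint ⟨hb0, hb.2⟩
      simp only [deriv_id'', one_mul] at key
      rw [key, intervalIntegral.integral_of_le hb0.le, integral_Ioc_eq_integral_Ioo]
  refine ⟨hσ, ?_, fun s t hs hst htT => ?_⟩
  · -- continuity of `F`: a constant plus the primitive of an integrable function
    have hprim := intervalIntegral.continuousOn_primitive_interval (μ := volume) (a := (0 : ℝ)) (b := T)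
      (f := fun τ => ∫ x, 2 * ((m : ℝ) + 3) * cylRadius x ^ (2 * m + 5) *
        angVortQuot (v τ) x ^ (2 * m + 5) * angVortQuot (timeDerivWithin (Icc 0 T) v τ) x)
      (by rw [uIcc_of_le hT.le]; exact hσ')
    rw [uIcc_of_le hT.le] at hprim
    exact (continuousOn_const.add hprim).congr fun b hb => hF b hb
  · have htI : t ∈ Icc 0 T := ⟨hs.trans hst, htT⟩
    have hsI : s ∈ Icc 0 T := ⟨hs, hst.trans htT⟩
    rw [hF t htI, hF s hsI, add_sub_add_left_eq_sub,
      intervalIntegral.integral_interval_sub_left (hσi 0 t (left_mem_Icc.2 hT.le) htI)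
        (hσi 0 s (left_mem_Icc.2 hT.le) hsI)]

end TaoClass

end Literature.Analysis.FluidPDE

end
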